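import Literature.MathematicalPhysics.QuantumFieldTheory.Balaban1983to89.B9Thm314QGQFlatV1
import Literature.MathematicalPhysics.QuantumFieldTheory.Balaban1983to89.B6Cor28KLevelV1

/-!
# `Balaban1983to89.B9Thm314HFlatV1Transfer` — [B9] THEOREM 3.14 (pp. 426–427, (3.154)) AT `U = 1` FOR THE GENUINE `k`-LEVEL
`H = GQ*(QGQ*)⁻¹ = GE ∘ QsE ∘ EE (domT hN D hk)` (the operator of [4] Corollary 2.8) ON THE V1 TORUS, FILE H1 OF 2: THE TRANSFER
IDENTITY AND THE SURVIVING TERMS, GENERIC IN THE LEFT FACTOR `T` (any operator of the fine bond functions with a (2.136)-type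
majorant `A·Φ(y)·e^{−δd_T}`: `T = G` gives the entry `|H(b,c)|` of (2.151), `T = ∇_νG` the entry `|(∇H)(b,c)|`) — hypothesis-level engine;
theorems + three `def`s with bodies (the column `(Tq_u)(f)` of `TQ*` and the two transfer kernels); no existing module is touched; no
fact is minted

HEADER.  Unit `lit-balaban-p21` (literature-prover, Phase-2 proof seat), GENERATION 24, 2026-08-25; referee-facing records under
`run/shared/lean/pub/lit-balaban/`.  T. Bałaban, *Propagators for lattice gauge theories in a background field*, Commun. Math.
Phys. **99** (1985) 389–434 [Balaban1985BackgroundPropagators] = [B9], Sect. D, Theorem 3.14; [4] = T. Bałaban, *Propagators and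
renormalization transformations for lattice gauge theories. II*, Commun. Math. Phys. **96** (1984) 223–250 [Balaban1984PropagatorsII],
Corollary 2.8 (2.150)–(2.151) p. 249, Proposition 2.7 (2.149) p. 249, (2.136) p. 247.

FRAMING (verbatim cell line): statement-level skeleton of published theorems with citation tags; proofs where landed; nothing
here is a claim about the Yang–Mills mass gap.

SKELETON ROW: B9.Thm3.14 (owner r06) × B6.Cor2.8 (owner r03), cross-reference cells only («the cube Δ(y) and the point y′ in the
case of H»): the two-family comparison of the genuine `k`-level `H = GQ*(QGQ*)⁻¹` of r03's `B6Cor28KLevelV1` between two nested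
families on one V1 torus, at the hypothesis level (this file) and unconditionally (file H2 `B9Thm314HFlatV1MultiLevelTorus`).

WHAT IS PRINTED.  [B9] p. 426: «Let us take localizations determined by points y, y′ ∈ Ω^{(k)} (i.e. these are cubes Δ(y), Δ(y′) in
the case of operators G′, G, G₁, 𝔊, the cube Δ(y) and the point y′ in the case of H, H₁, and the points y, y′ in the case of
(Q′G′²Q′*)⁻¹, (QGQ*)⁻¹, etc.).»; p. 427: «**Theorem 3.14.** If we take a pair of operators constructed for the two sequences {Ω_j},
{Ω′_j}, then their difference satisfies all the inequalities characteristic for operators of the considered type, with the additional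
factor exp(−δ₀d(y, y′, Ω)), d(y, y′, Ω) = inf_{y₁∈Ωᶜ∩T^{(k)}}(|y − y₁| + |y₁ − y′|) (3.154) on the right-hand sides.  This theorem can be proved in
exactly the same way as the corresponding property in the theorem of [2]. We take random walk expansions for both operators, and in
the difference all terms for walks with localizations contained in Ω are cancelled. Remaining terms correspond to walks of the general
type (3.107), for which at least one localization X_i intersects Ωᶜ.»  [4] p. 249: «A kernel of the operator H,
(HB)(b) = Σ_{c∈𝔅}(L^{j(c)}η)^d H(b, c)B(c), (2.150) satisfies the inequality |H(b, c)|, |(∇H)(b, c)|, ‖(ζ∇H)(·, c)‖_α ≤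
O(1)[1, (L^jη)^{−1}, (L^jη)^{−1−α}(‖ζ‖_α + |ζ|)](L^{j′}η)^{−d}e^{−δ₅d(y,c₋)}, (1.151) b ∈ Δ(y) or supp ζ ⊂ Δ(y), y ∈ Λ_j, c₋ ∈ Λ_{j′}.
This Corollary and Proposition 2.6 are our main technical results.»; «**Proposition 2.7.** The operator (QGQ*)⁻¹ is given by the
convergent expansions of the form (2.86), and it satisfies the bound |(QGQ*)⁻¹(b, b′)| ≤ O(1)(L^jη)^{−2}(L^{j′}η)^{−d}e^{−½δ₄d(b,b′)},
b ∈ Λ_j, b′ ∈ Λ_{j′}. (2.149)».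

## WHAT THIS FILE CERTIFIES (kernel-checked; V1 torus `B6GlobalChartV1.PV`, families `domT hN D hk` of p21's `TDomains`; lattice units)

For two families `D, D′ : TDomains` on one torus, `Ω := Ω_k ∩ Ω′_k`, the common top index bonds `IsCT` (gen 20) with twins
`c ↦ c̃ = ⟨c.1, _⟩`, a fine bond `f` whose site has both levels `= k` (print's «cube Δ(y), y ∈ Ω^{(k)}»; `y(f) = blkV1 hN D f` is then a
common top block, §3) and a common top index bond `c` (print's «point y′»):
* §1 `colT` = the column `(Tq_u)(f)` of `TQ*` and its (2.136)-bound `abs_colT_le` (r03's `abs_apply_qwt_le_gen`); `entry_col_le` = ONE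
  term `|(QGQ*)⁻¹(u, c₀)|·|(Tq_u)(f)|` of (2.150) with the level factors absorbed by the torus (2.60) exactly as in r03's
  `B6Cor28KLevelV1.comp_entry_le` (output `≤ (F(y(f))/pref(y(f)))·S·2L^D e^{δ(ℓ+3)}·L²·L^{D+2}·e^{−½δd_T(y(f), βu)}·e^{−½δρ(u, c₀)}` —
  only the OUTPUT RATIO `F/pref` survives: `1` for `T = G`, `(L^kη)^{−1}` for `T = ∇G`, print's `[1, (L^jη)^{−1}]` of (2.151));
* §2 the transfer kernels `kerE c u = (QGQ*)⁻¹[D](u, c) − [u ct]·(QGQ*)⁻¹[D′](ũ, c̃)`, `kerT f v = [v ct]·(T[Ω]q_{v})(f) − (T[Ω′]q′_v)(f)`,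
  the twin bijection `sum_dite_isCT_eq`, and **THE TRANSFER IDENTITY `TH_sub_eq`**:
  `(T[Ω]Q*E e_c)(f) − (T[Ω′]Q′*E′e_c̃)(f) = Σ_{u∈𝔅[D]} kerE(c, u)·(Tq_u)(f) + Σ_{v∈𝔅[D′]} (QGQ*)⁻¹[D′](v, c̃)·kerT(f, v)` — the algebraic
  form of «in the difference all terms for walks with localizations contained in Ω are cancelled»
  (`TQ*E − T′Q′*E′𝟙 = TQ*(E − 𝟙*E′𝟙) + (TQ*𝟙* − T′Q′*)E′𝟙`, `𝟙` the identification of the common top index bonds);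
* §3 `f ∈ Ω` ⇒ `y(f)`, `y′(f)` are common top blocks with one label; `qdiff_inside_le` = the two-family bound of `(T − T′)q′_v` at `f` for a
  common top `v` whose tube lies in `Ω`, block by block from the Theorem-3.14 shape of `T` (hypothesis `hTΔ` with prefactor `C·Φ(y)·B`,
  the literal conclusion shape of gen-20 `B9Thm314GFlatV1Transfer.thm314_G_flat_V1` (`Φ = pref`) / `thm314_gradG_flat_V1` (`Φ = len·|c_f|⁻¹`));
* §4 **THE SURVIVING TERMS** `abs_kerE_mul_colT_le`, `abs_ent_mul_kerT_le`: every term of the two sums is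
  `≤ K·(Φ(y(f))/pref(y(f)))·e^{δ(ℓ+7)}·e^{−¼δ·d(y(f), βc, Ω)}·(e^{−¼δd_T(y(f), βu)} resp. e^{−¼δρ′(c̃, v)})` — five cases: `u` common top
  (the Theorem-3.14 bound of `(QGQ*)⁻¹`, hypothesis `hEΔ` = file Q3's shape), `u` not (one-family (2.136)×(2.149), the `Ωᶜ` witness
  `exists_witness_of_not_isCT` within `L + 2` of `βu`), `v` common top with tube inside `Ω` (§3), `v` common top with tube meeting `Ωᶜ`
  (`exists_bad_site_of_not_inside`, trivial two-term bound), `v` not (mirror of the second case);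
* §5 **`TH_sub_omega_le`** (the two sums by the fibre sum `sum_comp_beta_le` and (2.61)) and §6 **`thm314_TH_of_hyps`**: the geometric
  mean with the one-family (2.151) decays (`B9Thm314GpFlatMultiLevelTorus.combined_bound`):
  `|(TQ*E e_c)(f) − (T′Q′*E′e_c̃)(f)| ≤ √(2C_H)·√(K_Ω·Φ(y(f))/pref(y(f)))·e^{−¼δ·min(d_T(y(f),βc), d_T′(y′(f),β′c̃))}·e^{−⅛δ·d(y(f), βc, Ω)}`.

## HONEST SCOPE

* `U = 1` only (no background field; [B9] states Theorem 3.14 for regular `U`); V1 torus lineage (`Ω₁ = T_η`, levels `1 … k`, lattice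
  units, `D = d + 1`); HYPOTHESIS-LEVEL in the (2.136)-type majorants `A·Φ·e^{−δd_T}` of `T`, `T′` (one constant `A`, the same shape
  function read in the two families, equal at `y(f)`, `y′(f)`), the (2.149) entries, the two Theorem-3.14 shapes (`hEΔ`, `hTΔ`), the (2.60)
  threshold, the (2.61) profiles and the one-family (2.151) decays at the fine bond `f` — all fed in file H2 from r03's
  `prop27_kLevel_unconditional`, `cor28_kLevel_H_DH`, p38's (2.136)₁,₂, this seat's `thm314_G_flat_V1` / `thm314_gradG_flat_V1` /
  `thm314_QGQinv_flat_V1` and `consts_260_261`.  Only fine bonds in `Ω` and COMMON TOP index bonds `c` (print's «y, y′ ∈ Ω^{(k)}»); (3.154)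
  as in `B9Thm314GpFlatTorusGeometry` (`k`-block labels, torus sup-distance in units of `L^k`, `inf ∅ := 0`).  The entries `|H(b, c)|`,
  `|(∇H)(b, c)|` of (2.151) are the instances `T = G`, `T = ∇_νG` (file H2); no Hölder quotient.
* ROUTE (declared): print's walk-expansion cancellation is replaced by the transfer identity §2 through the identification of the
  common top index bonds; the surviving terms are classified by whether the intermediate index bond is a common top one and whether its
  tube lies in `Ω`, exactly as print's «at least one localization X_i intersects Ωᶜ».  Same architecture as files Q1–Q3
  (`B9Thm314QGQ…V1…`) for `(QGQ*)⁻¹`.  Constants ours, not optimised.  Nothing is inferred from the manuscript: every step is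
  kernel-checked; the quoted sentences locate the statements.  NOT summit progress.

v1.1 (doc-only, D-g110-2 of ref-4 gen 110): the (3.154) display in the Theorem 3.14 quotation above now reads verbatim «d(y, y′, Ω) = inf_{y₁∈Ωᶜ∩T^{(k)}}(|y − y₁| + |y₁ − y′|)» (v1.0 had «inf_{x∈Ωᶜ}(|y − x| + |x − y′|)»); declarations byte-identical.
-/

noncomputable section

open scoped BigOperators InnerProductSpace
open Finset

namespace Literature.MathematicalPhysics.QuantumFieldTheory.Balaban1983to89.B9Thm314HFlatV1Transfer

open B4Reflection242 (boxDom blk)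
open B6MultiLevelBoxOperator (N0)
open B6MultiLevelTorusOperator (TDomains)
open B6Geom246MultiLevelBox (bset blkOf blkOf_val)
open B6Geom246MultiLevelTorus (geomT)
open B6SectAOperatorsV1 (QE QsE BondIdx BondIdxSpace)
open B6SectAVectorModelV1 (GE EE)
open B6GlobalChartV1 (PV toBox domT blkV1)
open B6Ineq2142KLevelV1 (lvl lvl_le_mK β beta_level qwt qwt_le qwt_nonneg metBlocks mem_metBlocks exists_of_mem_metBlocks
  card_metBlocks_le)
open B6Prop27KLevelV1 (wt lam lam_pos lam_sq rho rho_isPseudoDist)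
open B6RandomWalk (HasMajorant BlockSupp blockPiece sum_blockPiece blockSupp_blockPiece)
open B6Ineq2133TwoScaleV1 (onFun onFun_apply)
open B6Prop26KLevelSkeletonV1 (pref pref_nonneg)
open B6Prop26KLevelAssemblyV1 (distT_nonneg)
open B6Lemma21Repaired (Ineq261With)
open B6Cor28KLevelV1 (H_single_apply comp_QsE_EE_single_apply onFun_comp abs_apply_qwt_le_gen sum_comp_beta_le powL_lgap_le
  pref_le_pow_lgap_mul pref_pos volInv_mul_lamInv_eq lam_le_absorb one_le_L)
open B9Thm314GpFlatTorusGeometry (OmegaC blk_mem_OmegaC tdistK tdistK_nonneg dOmega dOmega_nonneg dOmega_le)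
open B9Thm314QGGQInvFlatTransfer (tdistK_triangle tdistK_comm dOmega_le_tdistK_add dOmega_le_add_tdistK tdistK_le_distT_of_top)
open B9Thm314GFlatV1Transfer (tdistK_blk_le_of_top)
open B9Thm314GFlatV1Kernel (IsCT)
open B9Thm314GpFlatMultiLevelTorus (combined_bound)
open B9Thm314QGQInvFlatV1Transfer (ent ent_eq_inner inner_EE_eq_ent lam_twin lam_twin' tdistK_twin_le tdistK_twin_le'
  tdistK_le_rho_of_top exists_witness_of_not_isCT exists_witness_of_not_isCT')
open B9Thm314QGQFlatV1 (common_top_of_levs levs_of_tube tdistK_tube_beta_le qwt_twin' lam_mul_lam_of_top blockPiece_qwt_eq_zero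
  exists_bad_site_of_not_inside)
open B5Eq118OneStroke (iterBlockOf)

/-! ## §0  Exponential bookkeeping -/

section Bookkeeping

/-- rate monotonicity: `e^{−rx} ≤ e^{−r′x}` for `r′ ≤ r`, `x ≥ 0`. [cite: Balaban1985BackgroundPropagators, (3.154) p.427 («after adjusting a definition of δ₀»), bookkeeping] -/
theorem exp_rate_mono {r r' x : ℝ} (h : r' ≤ r) (hx : 0 ≤ x) : Real.exp (-(r * x)) ≤ Real.exp (-(r' * x)) :=
  Real.exp_le_exp.2 (by nlinarith)

/-- the (3.154) chain bookkeeping: if `d(y, y′, Ω) ≤ a + b + C` then `e^{−ra}·e^{−rb} ≤ e^{½rC}·e^{−½r·d(y,y′,Ω)}·e^{−½ra}` (half of the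
rate of `a` is kept for the Lemma-2.1 sum, `b` is spent). [cite: Balaban1985BackgroundPropagators, (3.154) p.427, bookkeeping] -/
theorem exp_chain {r a b C dΩ : ℝ} (hr : 0 ≤ r) (hb : 0 ≤ b) (h : dΩ ≤ a + b + C) :
    Real.exp (-(r * a)) * Real.exp (-(r * b))
      ≤ Real.exp (r / 2 * C) * Real.exp (-(r / 2 * dΩ)) * Real.exp (-(r / 2 * a)) := by
  have e1 : Real.exp (-(r * a)) * Real.exp (-(r * b)) = Real.exp (-(r * a) + -(r * b)) := by rw [Real.exp_add]
  have e2 : Real.exp (r / 2 * C) * Real.exp (-(r / 2 * dΩ)) * Real.exp (-(r / 2 * a))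
      = Real.exp (r / 2 * C + -(r / 2 * dΩ) + -(r / 2 * a)) := by rw [Real.exp_add, Real.exp_add]
  rw [e1, e2, Real.exp_le_exp]
  nlinarith [mul_le_mul_of_nonneg_left h hr, mul_nonneg hr hb]

/-- the same bookkeeping with the second distance kept: `e^{−ra}·e^{−rb} ≤ e^{½rC}·e^{−½r·d(y,y′,Ω)}·e^{−½rb}`.
[cite: Balaban1985BackgroundPropagators, (3.154) p.427, bookkeeping] -/
theorem exp_chain' {r a b C dΩ : ℝ} (hr : 0 ≤ r) (ha : 0 ≤ a) (h : dΩ ≤ a + b + C) :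
    Real.exp (-(r * a)) * Real.exp (-(r * b))
      ≤ Real.exp (r / 2 * C) * Real.exp (-(r / 2 * dΩ)) * Real.exp (-(r / 2 * b)) := by
  have e1 : Real.exp (-(r * a)) * Real.exp (-(r * b)) = Real.exp (-(r * a) + -(r * b)) := by rw [Real.exp_add]
  have e2 : Real.exp (r / 2 * C) * Real.exp (-(r / 2 * dΩ)) * Real.exp (-(r / 2 * b))
      = Real.exp (r / 2 * C + -(r / 2 * dΩ) + -(r / 2 * b)) := by rw [Real.exp_add, Real.exp_add]
  rw [e1, e2, Real.exp_le_exp]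
  nlinarith [mul_le_mul_of_nonneg_left h hr, mul_nonneg hr ha]

/-- the common final shape of the five cases: monotonicity in the constant, the exponential constant and the two decay factors.
[cite: Balaban1985BackgroundPropagators, (3.154) p.427, bookkeeping] -/
theorem final_shape {X K K' E E' a a' b b' : ℝ} (hX : X ≤ K * (E * a * b)) (hK : 0 ≤ K) (hKK : K ≤ K') (hE0 : 0 ≤ E)
    (hEE : E ≤ E') (ha0 : 0 ≤ a) (haa : a ≤ a') (hb0 : 0 ≤ b) (hbb : b ≤ b') :
    X ≤ K' * E' * a' * b' := by
  have hE'0 : 0 ≤ E' := hE0.trans hEE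
  have ha'0 : 0 ≤ a' := ha0.trans haa
  calc X ≤ K * (E * a * b) := hX
    _ ≤ K' * (E' * a' * b') :=
        mul_le_mul hKK (mul_le_mul (mul_le_mul hEE haa ha0 hE'0) hbb hb0 (mul_nonneg hE'0 ha'0)) (by positivity) (hK.trans hKK)
    _ = K' * E' * a' * b' := by ring

end Bookkeeping

variable {d ℓ m K : ℕ} {hd : 1 ≤ d + 1} {hL : Odd (ℓ + 1) ∧ 1 < ℓ + 1}
variable {Mh k R : ℕ} {P' : Fin (d + 1) → ℕ}

/-! ## §1  The column `(Tq_u)(f)` of `TQ*` and one term of (2.150) with the level factors absorbed -/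

section Column

variable (hN : ∀ μ, N0 ℓ Mh k P' μ = (PV d ℓ m K hd hL).sitesPerDir 0) (D₀ : TDomains d ℓ Mh k P' R) (hk : k ≤ m + K)
variable {cf : ℝ} (hcf : cf ≠ 0) {w₀ : BondIdx (domT hN D₀ hk) → ℝ} (hw₀ : ∀ i, 0 < w₀ i)

/-- **THE COLUMN `(Tq_u)(f)` OF `TQ*`**: an operator `T` of the fine bond functions (`T = G = Δ_a⁻¹` for `H`, `T = ∇_νG` for `∇H`)
applied to the weight function `q_u` of the average `(Q·)_u`, read at the fine bond `f` (the kernel of `TQ*` in (2.150)).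
[cite: Balaban1984PropagatorsII, (2.150) p.249, (2.130) p.246] -/
def colT (T : Module.End ℝ (PBond (PV d ℓ m K hd hL) 0 → ℝ)) (u : BondIdx (domT hN D₀ hk)) (f : PBond (PV d ℓ m K hd hL) 0) : ℝ :=
  T (qwt hN D₀ hk u) f

/-- unfolding `colT`. [cite: Balaban1984PropagatorsII, (2.150) p.249, dictionary] -/
theorem colT_eq (T : Module.End ℝ (PBond (PV d ℓ m K hd hL) 0 → ℝ)) (u : BondIdx (domT hN D₀ hk)) (f : PBond (PV d ℓ m K hd hL) 0) :
    colT hN D₀ hk T u f = T (qwt hN D₀ hk u) f := rfl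

/-- **THE ENTRIES OF `TQ*(QGQ*)⁻¹` THROUGH THE INTERMEDIATE INDEX BOND** (r03's `comp_QsE_EE_single_apply` in the entry notation of
file Q2): `(TQ*(QGQ*)⁻¹e_c)(f) = Σ_u (QGQ*)⁻¹(u, c)·(Tq_u)(f)`. [cite: Balaban1984PropagatorsII, (2.150) p.249, (2.130) p.246] -/
theorem TH_single_eq_sum (T : Module.End ℝ (PBond (PV d ℓ m K hd hL) 0 → ℝ)) (c : BondIdx (domT hN D₀ hk))
    (f : PBond (PV d ℓ m K hd hL) 0) :
    (T ∘ₗ onFun (QsE (domT hN D₀ hk) ∘ₗ EE (domT hN D₀ hk) hcf hw₀)) (Pi.single c 1) f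
      = ∑ u, ent hN D₀ hk (EE (domT hN D₀ hk) hcf hw₀) u c * colT hN D₀ hk T u f := by
  rw [comp_QsE_EE_single_apply]
  refine Finset.sum_congr rfl fun u _ => ?_
  rw [inner_EE_eq_ent]
  rfl

/-- `H = GQ*(QGQ*)⁻¹` is the instance `T = G`: `(He_c)(f) = (G ∘ (Q*(QGQ*)⁻¹))(e_c)(f)`. [cite: Balaban1984PropagatorsII, (2.130) p.246, (2.150) p.249, dictionary] -/
theorem H_apply_eq_comp (c : BondIdx (domT hN D₀ hk)) (f : PBond (PV d ℓ m K hd hL) 0) :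
    (GE (domT hN D₀ hk) hcf hw₀ ∘ₗ QsE (domT hN D₀ hk) ∘ₗ EE (domT hN D₀ hk) hcf hw₀) (EuclideanSpace.single c (1 : ℝ)) f
      = (onFun (GE (domT hN D₀ hk) hcf hw₀) ∘ₗ onFun (QsE (domT hN D₀ hk) ∘ₗ EE (domT hN D₀ hk) hcf hw₀)) (Pi.single c 1) f := by
  rw [← onFun_comp, onFun_apply, PiLp.toLp_single]

/-- **THE (2.136)-TYPE BOUND OF A COLUMN**: `|(Tq_u)(f)| ≤ 2L^D·e^{δ(ℓ+3)}·(L^{j(u)D})⁻¹·F(y(f))·e^{−δd_T(y(f), βu)}` for a majorant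
`F(y)·e^{−δd_T}` of `T` (r03's `abs_apply_qwt_le_gen`). [cite: Balaban1984PropagatorsII, (2.136) p.247, (2.142) p.248, (2.150) p.249] -/
theorem abs_colT_le (hk1 : 1 ≤ k) (hRM : 2 ≤ R * Mh) (hMh : 1 ≤ Mh) (hP : ∀ μ, 1 ≤ P' μ)
    {T : Module.End ℝ (PBond (PV d ℓ m K hd hL) 0 → ℝ)} {F : ↥(bset D₀.toDomains) → ℝ} {δ : ℝ} (hF : ∀ y, 0 ≤ F y) (hδ : 0 ≤ δ)
    (hT : HasMajorant (g := geomT D₀) (blkV1 hN D₀) T (fun y y' => F y * Real.exp (-(δ * (geomT D₀).dist y y'))))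
    (u : BondIdx (domT hN D₀ hk)) (f : PBond (PV d ℓ m K hd hL) 0) :
    |colT hN D₀ hk T u f| ≤ 2 * (((ℓ + 1 : ℕ) : ℝ)) ^ (d + 1) * Real.exp (δ * ((ℓ : ℝ) + 3)) *
      ((((ℓ + 1 : ℕ) : ℝ) ^ (d + 1)) ^ (lvl hN D₀ hk u))⁻¹ * F (blkV1 hN D₀ f) *
        Real.exp (-(δ * (geomT D₀).dist (blkV1 hN D₀ f) (β hN D₀ hk u))) :=
  abs_apply_qwt_le_gen hN D₀ hk hk1 hRM hMh hP hF hδ hT u f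

/-- **ONE TERM OF (2.150) WITH THE LEVEL FACTORS ABSORBED** (the per-term step of r03's `B6Cor28KLevelV1.comp_entry_le`):
`|(QGQ*)⁻¹(u, c₀)|·|(Tq_u)(f)| ≤ (F(y(f))/pref(y(f)))·S·2L^De^{δ(ℓ+3)}·L²·L^{D+2}·e^{−½δd_T(y(f), βu)}·e^{−½δρ(u, c₀)}` — the output ratio
`pref(y(f))/pref(βu) ≤ L²e^{½δd_T}`, the middle-against-input ratio `Λ_u/Λ_{c₀} ≤ L^{D+2}e^{½δρ}` by the torus (2.60) under the
threshold `L^{D+2}e^{−½δ(R·L·M_h − 1)} ≤ 1`; only `F/pref` survives. [cite: Balaban1984PropagatorsII, Cor. 2.8 (2.150)–(2.151) p.249, (2.136) p.247, (2.149) p.249, (2.60) p.234, (2.88) p.238] -/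
theorem entry_col_le (hk1 : 1 ≤ k) (hRM : 2 ≤ R * Mh) (hMh : 1 ≤ Mh) (hP : ∀ μ, 1 ≤ P' μ)
    {T : Module.End ℝ (PBond (PV d ℓ m K hd hL) 0 → ℝ)} {F : ↥(bset D₀.toDomains) → ℝ} {S δ : ℝ}
    (hF : ∀ y, 0 ≤ F y) (hS : 0 ≤ S) (hδ : 0 ≤ δ)
    (hT : HasMajorant (g := geomT D₀) (blkV1 hN D₀) T (fun y y' => F y * Real.exp (-(δ * (geomT D₀).dist y y'))))
    (hE : ∀ a b : BondIdx (domT hN D₀ hk),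
      |⟪EuclideanSpace.single a (1 : ℝ), EE (domT hN D₀ hk) hcf hw₀ (EuclideanSpace.single b (1 : ℝ))⟫_ℝ| ≤
        (lam hN D₀ hk cf a)⁻¹ * (lam hN D₀ hk cf b)⁻¹ * (S * Real.exp (-(δ * rho hN D₀ hk a b))))
    (hsmall : ((ℓ : ℝ) + 1) ^ (d + 3) * Real.exp (-(δ / 2 * ((R : ℝ) * (((ℓ : ℝ) + 1) * Mh) - 1))) ≤ 1)
    (u c₀ : BondIdx (domT hN D₀ hk)) (f : PBond (PV d ℓ m K hd hL) 0) :
    |ent hN D₀ hk (EE (domT hN D₀ hk) hcf hw₀) u c₀| * |colT hN D₀ hk T u f|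
      ≤ F (blkV1 hN D₀ f) / pref cf (blkV1 hN D₀ f) * S * (2 * (((ℓ + 1 : ℕ) : ℝ)) ^ (d + 1) * Real.exp (δ * ((ℓ : ℝ) + 3)))
        * ((ℓ : ℝ) + 1) ^ 2 * ((ℓ : ℝ) + 1) ^ (d + 3)
        * (Real.exp (-(δ / 2 * (geomT D₀).dist (blkV1 hN D₀ f) (β hN D₀ hk u))) * Real.exp (-(δ / 2 * rho hN D₀ hk u c₀))) := by
  have hRM1 : 1 ≤ R * ((ℓ + 1) * Mh) := by
    have h1 : R * Mh ≤ R * ((ℓ + 1) * Mh) := Nat.mul_le_mul_left R (Nat.le_mul_of_pos_left Mh (Nat.succ_pos ℓ))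
    omega
  set yf := blkV1 hN D₀ f with hyf
  set Lr : ℝ := (ℓ : ℝ) + 1 with hLr
  set CG : ℝ := 2 * (((ℓ + 1 : ℕ) : ℝ)) ^ (d + 1) * Real.exp (δ * ((ℓ : ℝ) + 3)) with hCG
  have hCG0 : 0 ≤ CG := by positivity
  set d₁ := (geomT D₀).dist yf (β hN D₀ hk u) with hd₁
  set d₂ := rho hN D₀ hk u c₀ with hd₂
  have hd₁0 : 0 ≤ d₁ := distT_nonneg (D := D₀) _ _
  have hd₂0 : 0 ≤ d₂ := (rho_isPseudoDist hN D₀ hk hMh hP).nonneg u c₀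
  have hlu := lam_pos hN D₀ hk hcf u
  have hlc := lam_pos hN D₀ hk hcf c₀
  have hpf := pref_pos D₀ hcf yf
  have hpref' := pref_pos D₀ hcf (β hN D₀ hk u)
  set Φ : ℝ := F yf / pref cf yf with hΦ
  have hΦ0 : 0 ≤ Φ := div_nonneg (hF _) hpf.le
  have hFΦ : F yf = Φ * pref cf yf := by rw [hΦ, div_mul_cancel₀ _ hpf.ne']
  -- the two factors
  have hEuc : |ent hN D₀ hk (EE (domT hN D₀ hk) hcf hw₀) u c₀|
      ≤ (lam hN D₀ hk cf u)⁻¹ * (lam hN D₀ hk cf c₀)⁻¹ * (S * Real.exp (-(δ * d₂))) := by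
    rw [← inner_EE_eq_ent]; exact hE u c₀
  have hEpos : 0 ≤ (lam hN D₀ hk cf u)⁻¹ * (lam hN D₀ hk cf c₀)⁻¹ * (S * Real.exp (-(δ * d₂))) :=
    mul_nonneg (mul_nonneg (inv_nonneg.2 hlu.le) (inv_nonneg.2 hlc.le)) (mul_nonneg hS (Real.exp_pos _).le)
  have hGu := abs_colT_le hN D₀ hk hk1 hRM hMh hP hF hδ hT u f
  rw [hFΦ] at hGu
  have hprod : |ent hN D₀ hk (EE (domT hN D₀ hk) hcf hw₀) u c₀| * |colT hN D₀ hk T u f|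
      ≤ S * CG * Φ * (pref cf yf * (((((ℓ + 1 : ℕ) : ℝ) ^ (d + 1)) ^ (lvl hN D₀ hk u))⁻¹ * (lam hN D₀ hk cf u)⁻¹)
          * (lam hN D₀ hk cf c₀)⁻¹) * (Real.exp (-(δ * d₁)) * Real.exp (-(δ * d₂))) := by
    have h := mul_le_mul hEuc hGu (abs_nonneg _) hEpos
    refine h.trans (le_of_eq ?_)
    rw [hCG]; ring
  rw [volInv_mul_lamInv_eq hN D₀ hk hk1 hcf u] at hprod
  -- the level factors absorbed
  have hsmall2 : Lr ^ 2 * Real.exp (-(δ / 2 * ((R : ℝ) * (Lr * Mh) - 1))) ≤ 1 := by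
    refine le_trans (mul_le_mul_of_nonneg_right ?_ (Real.exp_pos _).le) hsmall
    exact pow_le_pow_right₀ (one_le_L (ℓ := ℓ)) (by omega)
  have hout : pref cf yf ≤ Lr ^ 2 * Real.exp (δ / 2 * d₁) * pref cf (β hN D₀ hk u) := by
    refine (pref_le_pow_lgap_mul D₀ cf yf (β hN D₀ hk u)).trans ?_
    exact mul_le_mul_of_nonneg_right (powL_lgap_le D₀ hMh hP hRM1 2 (by positivity) hsmall2 yf (β hN D₀ hk u)) hpref'.le
  have hin : lam hN D₀ hk cf u ≤ Lr ^ (d + 3) * Real.exp (δ / 2 * d₂) * lam hN D₀ hk cf c₀ :=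
    lam_le_absorb hN D₀ hk hk1 hMh hP hRM1 hcf hδ hsmall u c₀
  have hratio : pref cf yf * (lam hN D₀ hk cf u / pref cf (β hN D₀ hk u)) * (lam hN D₀ hk cf c₀)⁻¹ ≤
      (Lr ^ 2 * Real.exp (δ / 2 * d₁)) * (Lr ^ (d + 3) * Real.exp (δ / 2 * d₂)) := by
    rw [show pref cf yf * (lam hN D₀ hk cf u / pref cf (β hN D₀ hk u)) * (lam hN D₀ hk cf c₀)⁻¹ =
        (pref cf yf / pref cf (β hN D₀ hk u)) * (lam hN D₀ hk cf u / lam hN D₀ hk cf c₀) by field_simp]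
    refine mul_le_mul ?_ ?_ (div_nonneg hlu.le hlc.le) (mul_nonneg (pow_nonneg (by positivity) _) (Real.exp_pos _).le)
    · rw [div_le_iff₀ hpref']; exact hout
    · rw [div_le_iff₀ hlc]; exact hin
  have e1 : Real.exp (δ / 2 * d₁) * Real.exp (-(δ * d₁)) = Real.exp (-(δ / 2 * d₁)) := by
    rw [← Real.exp_add]; congr 1; ring
  have e2 : Real.exp (δ / 2 * d₂) * Real.exp (-(δ * d₂)) = Real.exp (-(δ / 2 * d₂)) := by
    rw [← Real.exp_add]; congr 1; ring
  calc |ent hN D₀ hk (EE (domT hN D₀ hk) hcf hw₀) u c₀| * |colT hN D₀ hk T u f|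
      ≤ S * CG * Φ * (pref cf yf * (lam hN D₀ hk cf u / pref cf (β hN D₀ hk u)) * (lam hN D₀ hk cf c₀)⁻¹)
          * (Real.exp (-(δ * d₁)) * Real.exp (-(δ * d₂))) := hprod
    _ ≤ S * CG * Φ * ((Lr ^ 2 * Real.exp (δ / 2 * d₁)) * (Lr ^ (d + 3) * Real.exp (δ / 2 * d₂)))
          * (Real.exp (-(δ * d₁)) * Real.exp (-(δ * d₂))) :=
        mul_le_mul_of_nonneg_right (mul_le_mul_of_nonneg_left hratio (mul_nonneg (mul_nonneg hS hCG0) hΦ0))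
          (mul_nonneg (Real.exp_pos _).le (Real.exp_pos _).le)
    _ = Φ * S * CG * Lr ^ 2 * Lr ^ (d + 3)
          * ((Real.exp (δ / 2 * d₁) * Real.exp (-(δ * d₁))) * (Real.exp (δ / 2 * d₂) * Real.exp (-(δ * d₂)))) := by ring
    _ = _ := by rw [e1, e2]

end Column

/-! ## §2  The transfer kernels and the transfer identity for `TQ*(QGQ*)⁻¹` -/

section Transfer

variable (hN : ∀ μ, N0 ℓ Mh k P' μ = (PV d ℓ m K hd hL).sitesPerDir 0) (D D' : TDomains d ℓ Mh k P' R) (hk : k ≤ m + K)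
variable {cf : ℝ} (hcf : cf ≠ 0) {w : BondIdx (domT hN D hk) → ℝ} (hw : ∀ i, 0 < w i)
  {w' : BondIdx (domT hN D' hk) → ℝ} (hw' : ∀ i, 0 < w' i)

/-- **THE TRANSFER KERNEL OF `(QGQ*)⁻¹`** against the identification `T` of the common top index bonds (`IsCT`: level `k`, in
`Λ_k ∩ Λ′_k`): `kerE(c, u) = (QGQ*)⁻¹[D](u, c) − [u common top]·(QGQ*)⁻¹[D′](ũ, c̃)` = the entries of `(E − T*E′T)e_c`.
[cite: Balaban1985BackgroundPropagators, Thm 3.14 p.427 («in the difference all terms for walks with localizations contained in Ω are cancelled»), dictionary] -/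
def kerE (c : BondIdx (domT hN D hk)) (hc : IsCT hN D D' hk c.1) (u : BondIdx (domT hN D hk)) : ℝ :=
  ent hN D hk (EE (domT hN D hk) hcf hw) u c
    - (if h : IsCT hN D D' hk u.1 then
        ent hN D' hk (EE (domT hN D' hk) hcf hw') ⟨u.1, h.2.2⟩ ⟨c.1, hc.2.2⟩ else 0)

/-- **THE TRANSFER KERNEL OF `TQ*`**: `kerT(f, v) = [v common top]·(T[Ω]q_{v_D})(f) − (T[Ω′]q′_v)(f)` = the columns of
`(TQ*𝟙* − T′Q′*)e_v` (`q_{v_D} = q′_v` for a common top `v`; `T`, `T′` the left factors of the two families).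
[cite: Balaban1985BackgroundPropagators, Thm 3.14 p.427, dictionary] -/
def kerT (T T' : Module.End ℝ (PBond (PV d ℓ m K hd hL) 0 → ℝ)) (f : PBond (PV d ℓ m K hd hL) 0) (v : BondIdx (domT hN D' hk)) : ℝ :=
  (if h : IsCT hN D D' hk v.1 then colT hN D hk T ⟨v.1, h.2.1⟩ f else 0) - colT hN D' hk T' v f

/-- **THE TWIN BIJECTION**: a sum over the common top index bonds read in `𝔅[D]` equals the same sum read in `𝔅[D′]`
(`u ↦ ũ = ⟨u.1, _⟩` is a bijection of the two filters). [cite: Balaban1985BackgroundPropagators, p.426 («Ω = Ω_k ∩ Ω′_k»), bookkeeping] -/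
theorem sum_dite_isCT_eq (F : (u : BondIdx (domT hN D hk)) → IsCT hN D D' hk u.1 → ℝ)
    (F' : (v : BondIdx (domT hN D' hk)) → IsCT hN D D' hk v.1 → ℝ)
    (h : ∀ (u : BondIdx (domT hN D hk)) (hu : IsCT hN D D' hk u.1),
      F u hu = F' (⟨u.1, hu.2.2⟩ : BondIdx (domT hN D' hk)) hu) :
    ∑ u, (if hu : IsCT hN D D' hk u.1 then F u hu else 0)
      = ∑ v, (if hv : IsCT hN D D' hk v.1 then F' v hv else 0) := by
  classical
  have hL : ∑ u ∈ Finset.univ.filter (fun u : BondIdx (domT hN D hk) => IsCT hN D D' hk u.1),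
        (if hu : IsCT hN D D' hk u.1 then F u hu else 0)
      = ∑ u, (if hu : IsCT hN D D' hk u.1 then F u hu else 0) :=
    Finset.sum_subset (Finset.filter_subset _ _) fun u _ hu => by
      rw [Finset.mem_filter, not_and] at hu
      exact dif_neg (hu (Finset.mem_univ u))
  have hR : ∑ v ∈ Finset.univ.filter (fun v : BondIdx (domT hN D' hk) => IsCT hN D D' hk v.1),
        (if hv : IsCT hN D D' hk v.1 then F' v hv else 0)
      = ∑ v, (if hv : IsCT hN D D' hk v.1 then F' v hv else 0) :=
    Finset.sum_subset (Finset.filter_subset _ _) fun v _ hv => by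
      rw [Finset.mem_filter, not_and] at hv
      exact dif_neg (hv (Finset.mem_univ v))
  rw [← hL, ← hR]
  refine Finset.sum_bij (fun u hu => (⟨u.1, ((Finset.mem_filter.1 hu).2).2.2⟩ : BondIdx (domT hN D' hk))) ?_ ?_ ?_ ?_
  · intro u hu
    exact Finset.mem_filter.2 ⟨Finset.mem_univ _, (Finset.mem_filter.1 hu).2⟩
  · intro u₁ hu₁ u₂ hu₂ heq
    apply Subtype.ext
    have h1 := congrArg Subtype.val heq
    exact h1
  · intro v hv
    have hct := (Finset.mem_filter.1 hv).2
    exact ⟨⟨v.1, hct.2.1⟩, Finset.mem_filter.2 ⟨Finset.mem_univ _, hct⟩, rfl⟩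
  · intro u hu
    have hct : IsCT hN D D' hk u.1 := (Finset.mem_filter.1 hu).2
    have hct' : IsCT hN D D' hk (⟨u.1, hct.2.2⟩ : BondIdx (domT hN D' hk)).1 := hct
    rw [dif_pos hct, dif_pos hct']
    exact h u hct

/-- **THE TRANSFER IDENTITY FOR `TQ*(QGQ*)⁻¹`** (`T = G`: `H`; `T = ∇_νG`: `∇_νH`): for a common top index bond `c` (read in `𝔅[D]`,
twin `c̃ ∈ 𝔅[D′]`) and any fine bond `f`,
`(T[Ω]Q*E e_c)(f) − (T[Ω′]Q′*E′ e_c̃)(f) = Σ_{u∈𝔅[D]} kerE(c, u)·(T[Ω]q_u)(f) + Σ_{v∈𝔅[D′]} (QGQ*)⁻¹[D′](v, c̃)·kerT(f, v)`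
— the entrywise form of `TQ*E − T′Q′*E′𝟙 = TQ*(E − 𝟙*E′𝟙) + (TQ*𝟙* − T′Q′*)E′𝟙` (the parts of both sums over the common top index
bonds with both kernels of one family are matched by the twin bijection and cancel: the algebraic form, at `U = 1`, of «in the
difference all terms for walks with localizations contained in Ω are cancelled»).
[cite: Balaban1985BackgroundPropagators, Thm 3.14 p.427; Balaban1984PropagatorsII, (2.150) p.249, (2.130) p.246] -/
theorem TH_sub_eq (T T' : Module.End ℝ (PBond (PV d ℓ m K hd hL) 0 → ℝ)) (c : BondIdx (domT hN D hk)) (hc : IsCT hN D D' hk c.1)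
    (f : PBond (PV d ℓ m K hd hL) 0) :
    (T ∘ₗ onFun (QsE (domT hN D hk) ∘ₗ EE (domT hN D hk) hcf hw)) (Pi.single c 1) f
      - (T' ∘ₗ onFun (QsE (domT hN D' hk) ∘ₗ EE (domT hN D' hk) hcf hw'))
          (Pi.single (⟨c.1, hc.2.2⟩ : BondIdx (domT hN D' hk)) 1) f
    = ∑ u, kerE hN D D' hk hcf hw hw' c hc u * colT hN D hk T u f
      + ∑ v, ent hN D' hk (EE (domT hN D' hk) hcf hw') v ⟨c.1, hc.2.2⟩ * kerT hN D D' hk T T' f v := by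
  classical
  rw [TH_single_eq_sum, TH_single_eq_sum]
  -- the common top parts of the two mixed sums agree (twin bijection)
  have hct : ∑ u : BondIdx (domT hN D hk),
      (if hu : IsCT hN D D' hk u.1 then
        ent hN D' hk (EE (domT hN D' hk) hcf hw') ⟨u.1, hu.2.2⟩ ⟨c.1, hc.2.2⟩ * colT hN D hk T u f else 0)
      = ∑ v : BondIdx (domT hN D' hk),
      (if hv : IsCT hN D D' hk v.1 then
        ent hN D' hk (EE (domT hN D' hk) hcf hw') v ⟨c.1, hc.2.2⟩ * colT hN D hk T ⟨v.1, hv.2.1⟩ f else 0) :=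
    sum_dite_isCT_eq hN D D' hk _ _ fun u hu => rfl
  have e1 : ∑ u, kerE hN D D' hk hcf hw hw' c hc u * colT hN D hk T u f
      = ∑ u, ent hN D hk (EE (domT hN D hk) hcf hw) u c * colT hN D hk T u f
        - ∑ u : BondIdx (domT hN D hk), (if hu : IsCT hN D D' hk u.1 then
            ent hN D' hk (EE (domT hN D' hk) hcf hw') ⟨u.1, hu.2.2⟩ ⟨c.1, hc.2.2⟩ * colT hN D hk T u f else 0) := by
    rw [← Finset.sum_sub_distrib]
    refine Finset.sum_congr rfl fun u _ => ?_
    unfold kerE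
    split_ifs with hu <;> ring
  have e2 : ∑ v, ent hN D' hk (EE (domT hN D' hk) hcf hw') v ⟨c.1, hc.2.2⟩ * kerT hN D D' hk T T' f v
      = ∑ v : BondIdx (domT hN D' hk), (if hv : IsCT hN D D' hk v.1 then
            ent hN D' hk (EE (domT hN D' hk) hcf hw') v ⟨c.1, hc.2.2⟩ * colT hN D hk T ⟨v.1, hv.2.1⟩ f else 0)
        - ∑ v, ent hN D' hk (EE (domT hN D' hk) hcf hw') v ⟨c.1, hc.2.2⟩ * colT hN D' hk T' v f := by
    rw [← Finset.sum_sub_distrib]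
    refine Finset.sum_congr rfl fun v _ => ?_
    unfold kerT
    split_ifs with hv <;> ring
  rw [e1, e2, hct]
  ring

end Transfer

/-! ## §3  `f ∈ Ω`: the output block is a common top block; the two-family bound of `(T − T′)q′_v` for a tube inside `Ω` -/

section Inside

variable (hN : ∀ μ, N0 ℓ Mh k P' μ = (PV d ℓ m K hd hL).sitesPerDir 0) (D D' : TDomains d ℓ Mh k P' R) (hk : k ≤ m + K)

/-- **A FINE BOND OF `Ω` LIES IN A COMMON TOP BLOCK, WITH ONE LABEL IN BOTH FAMILIES**: if both level functions are `= k` at the site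
of `f`, then `y(f) = blkV1 hN D f` and `y′(f) = blkV1 hN D′ f` are top blocks of both families with the same `k`-label, and the same
prefactor `pref = (L^kη)²`. [cite: Balaban1985BackgroundPropagators, p.426 («y, y′ ∈ Ω^{(k)}»); Balaban1984PropagatorsII, (2.1) p.224] -/
theorem blkV1_common_top (f : PBond (PV d ℓ m K hd hL) 0) (hfD : D.lev (toBox hN f.src).1 = k)
    (hfD' : D'.lev (toBox hN f.src).1 = k) :
    (blkV1 hN D f).1.1 = k ∧ (blkV1 hN D f).1 ∈ bset D'.toDomains ∧ (blkV1 hN D' f).1.1 = k ∧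
      (blkV1 hN D' f).1 ∈ bset D.toDomains ∧ (blkV1 hN D' f).1.2 = (blkV1 hN D f).1.2 := by
  obtain ⟨h1, h2, h3⟩ := common_top_of_levs D D' (toBox hN f.src) hfD hfD'
  obtain ⟨h1', h2', h3'⟩ := common_top_of_levs D' D (toBox hN f.src) hfD' hfD
  exact ⟨h1, h2, h1', h2', h3'.trans h3.symm⟩

/-- the prefactors of `y(f)` and `y′(f)` agree (both `= (L^k/c_f)²`). [cite: Balaban1984PropagatorsII, (2.136) p.247, bookkeeping] -/
theorem pref_blkV1_eq (cf : ℝ) (f : PBond (PV d ℓ m K hd hL) 0) (hfD : D.lev (toBox hN f.src).1 = k)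
    (hfD' : D'.lev (toBox hN f.src).1 = k) :
    pref cf (blkV1 hN D' f) = pref cf (blkV1 hN D f) := by
  obtain ⟨h1, -, h1', -, -⟩ := blkV1_common_top hN D D' f hfD hfD'
  unfold pref
  rw [h1, h1']

/-- `pref(y(f))·L^{−kD} = Λ_u·Λ′_v` for common top `u ∈ 𝔅[D₁]`, `v ∈ 𝔅[D₂]` and `y(f)` a top block: the (2.142) size factor.
[cite: Balaban1984PropagatorsII, (2.142) p.248, (2.81) p.237, bookkeeping] -/
theorem pref_mul_volInv_eq (D₁ D₂ : TDomains d ℓ Mh k P' R) (cf : ℝ) {y : ↥(bset D.toDomains)} (hy : y.1.1 = k)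
    (u : BondIdx (domT hN D₁ hk)) (hu : (u.1.1 : ℕ) = k) (v : BondIdx (domT hN D₂ hk)) (hv : (v.1.1 : ℕ) = k) :
    pref cf y * ((((ℓ + 1 : ℕ) : ℝ) ^ (d + 1)) ^ k)⁻¹ = lam hN D₁ hk cf u * lam hN D₂ hk cf v := by
  rw [lam_mul_lam_of_top hN D₁ D₂ hk cf u hu v hv]
  unfold pref
  rw [hy]

variable {cf : ℝ} (hcf : cf ≠ 0) {w : BondIdx (domT hN D hk) → ℝ} (hw : ∀ i, 0 < w i)
  {w' : BondIdx (domT hN D' hk) → ℝ} (hw' : ∀ i, 0 < w' i)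

/-- **`(T − T′)q′_v` AT A FINE BOND OF `Ω`, TUBE OF `v` INSIDE `Ω`**: from the two-family bound of `T[Ω] − T[Ω′]` between common
top blocks (`hTΔ` with prefactor `C·Φ(y)·B`, the conclusion shape of this seat's `B9Thm314GFlatV1Transfer.thm314_G_flat_V1` /
`thm314_gradG_flat_V1`), for a common top `v ∈ 𝔅[D′]` whose tube lies in `Ω` and a fine bond `f` with both levels `= k` at its site:
`|((T′ − T)q′_v)(f)| ≤ 2L^D·C·e^{3δ}·Φ(y(f))(L^{kD})⁻¹·e^{−δd(y(f), β′v, Ω)}` (`q′_v` split over the `≤ 2L^D` blocks met by its tube,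
each a common top block `k`-close to `β′v`; `|q′_v| ≤ L^{−kD}`) — the variant of file Q1's `contour_inside_le` with the output fine bond
in `Ω` instead of in a tube. [cite: Balaban1985BackgroundPropagators, Thm 3.14 (3.154) p.427; Balaban1984PropagatorsII, (2.150) p.249] -/
theorem qdiff_inside_le (hk1 : 1 ≤ k) (hRM : 2 ≤ R * Mh) (hMh : 1 ≤ Mh) (hP : ∀ μ, 1 ≤ P' μ)
    {T T' : Module.End ℝ (PBond (PV d ℓ m K hd hL) 0 → ℝ)} {Φ : ↥(bset D.toDomains) → ℝ} {CG δ : ℝ} (hΦ : ∀ y, 0 ≤ Φ y)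
    (hC : 0 ≤ CG) (hδ : 0 ≤ δ)
    (hTΔ : ∀ (y : ↥(bset D.toDomains)) (hyD' : y.1 ∈ bset D'.toDomains) (y' : ↥(bset D'.toDomains))
        (hy'D : y'.1 ∈ bset D.toDomains), y.1.1 = k → y'.1.1 = k →
        ∀ (μ : PBond (PV d ℓ m K hd hL) 0 → ℝ) (B : ℝ), BlockSupp (g := geomT D') (blkV1 hN D') μ y' B →
        ∀ x : PBond (PV d ℓ m K hd hL) 0, blkV1 hN D x = y →
          |T μ x - T' μ x|
            ≤ CG * (Φ y * B)
              * Real.exp (-(δ * min ((geomT D).dist y ⟨y'.1, hy'D⟩) ((geomT D').dist ⟨y.1, hyD'⟩ y')))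
              * Real.exp (-(δ * dOmega D D' y.1.2 y'.1.2)))
    (v : BondIdx (domT hN D' hk)) (hv : IsCT hN D D' hk v.1)
    (hvs : v.1.2.src ∈ (domT hN D' hk).Om (lvl hN D' hk v)) (hvt : v.1.2.tgt ∈ (domT hN D' hk).Om (lvl hN D' hk v))
    (hvs' : v.1.2.src ∈ (domT hN D hk).Om (lvl hN D' hk v)) (hvt' : v.1.2.tgt ∈ (domT hN D hk).Om (lvl hN D' hk v))
    (f : PBond (PV d ℓ m K hd hL) 0) (hfD : D.lev (toBox hN f.src).1 = k) (hfD' : D'.lev (toBox hN f.src).1 = k) :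
    |T' (qwt hN D' hk v) f - T (qwt hN D' hk v) f|
      ≤ 2 * (((ℓ + 1 : ℕ) : ℝ)) ^ (d + 1) * CG * Real.exp (3 * δ)
          * (Φ (blkV1 hN D f) * ((((ℓ + 1 : ℕ) : ℝ) ^ (d + 1)) ^ k)⁻¹)
          * Real.exp (-(δ * dOmega D D' (blkV1 hN D f).1.2 (β hN D' hk v).1.2)) := by
  classical
  have hdT := B6Prop23MultiLevelTorus.isPseudoDist_distT D hMh hP
  have hdT' := B6Prop23MultiLevelTorus.isPseudoDist_distT D' hMh hP
  set q := qwt hN D' hk v with hq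
  set Td : Module.End ℝ (PBond (PV d ℓ m K hd hL) 0 → ℝ) := T' - T with hTd
  -- the output block `y = y(f)` is a common top block
  obtain ⟨hy, hyD', -⟩ := common_top_of_levs D D' (toBox hN f.src) hfD hfD'
  -- the size of `q′_v`
  set B : ℝ := ((((ℓ + 1 : ℕ) : ℝ) ^ (d + 1)) ^ k)⁻¹ with hB
  have hB0 : 0 ≤ B := by positivity
  have hqB : ∀ x, |q x| ≤ B := fun x => by
    rw [abs_of_nonneg (qwt_nonneg hN D' hk v x)]
    have h := qwt_le hN D' hk v x
    have e : lvl hN D' hk v = k := hv.1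
    rw [e] at h
    exact h
  -- the constant per block
  set W : ℝ := Φ (blkV1 hN D f) * ((((ℓ + 1 : ℕ) : ℝ) ^ (d + 1)) ^ k)⁻¹ with hW
  have hW0 : 0 ≤ W := mul_nonneg (hΦ _) hB0
  -- each piece
  have hpiece : ∀ z ∈ metBlocks hN D' hk v,
      |Td (blockPiece (g := geomT D') (blkV1 hN D') z q) f|
        ≤ CG * W * (Real.exp (3 * δ) * Real.exp (-(δ * dOmega D D' (blkV1 hN D f).1.2 (β hN D' hk v).1.2))) := by
    intro z hz
    obtain ⟨z₀, hz₀, rfl⟩ := exists_of_mem_metBlocks hN D' hk v hz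
    obtain ⟨hD'z, hDz⟩ := levs_of_tube hN hk D' D hk1 v hv.1 hvs hvt hvs' hvt' hz₀
    obtain ⟨hzk, hzD, hzlab⟩ := common_top_of_levs D' D (toBox hN z₀) hD'z hDz
    have hsupp := blockSupp_blockPiece (g := geomT D') (blkV1 hN D') q (blkOf D'.toDomains (toBox hN z₀)) B hB0 (fun x _ => hqB x)
    have h := hTΔ (blkV1 hN D f) hyD' (blkOf D'.toDomains (toBox hN z₀)) hzD hy hzk _ B hsupp f rfl
    have hTapp : Td (blockPiece (g := geomT D') (blkV1 hN D') (blkOf D'.toDomains (toBox hN z₀)) q) f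
        = T' (blockPiece (g := geomT D') (blkV1 hN D') (blkOf D'.toDomains (toBox hN z₀)) q) f
          - T (blockPiece (g := geomT D') (blkV1 hN D') (blkOf D'.toDomains (toBox hN z₀)) q) f := by
      rw [hTd, LinearMap.sub_apply, Pi.sub_apply]
    rw [hTapp, abs_sub_comm]
    refine h.trans ?_
    -- `e^{−δ min} ≤ 1`, `pref·B = W`, and the (3.154) chain through the block of `z₀` (within `3` of `β′v` on `T^{(k)}`)
    have hmin : Real.exp (-(δ * min ((geomT D).dist (blkV1 hN D f) ⟨(blkOf D'.toDomains (toBox hN z₀)).1, hzD⟩)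
        ((geomT D').dist ⟨(blkV1 hN D f).1, hyD'⟩ (blkOf D'.toDomains (toBox hN z₀))))) ≤ 1 := by
      rw [Real.exp_le_one_iff]
      have h1 := hdT.nonneg (blkV1 hN D f) ⟨(blkOf D'.toDomains (toBox hN z₀)).1, hzD⟩
      have h2 := hdT'.nonneg ⟨(blkV1 hN D f).1, hyD'⟩ (blkOf D'.toDomains (toBox hN z₀))
      have := le_min h1 h2
      nlinarith
    have hzv : tdistK (ℓ := ℓ) (Mh := Mh) (k := k) (P := P') (blkOf D'.toDomains (toBox hN z₀)).1.2 (β hN D' hk v).1.2 ≤ 3 := by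
      rw [hzlab]
      exact tdistK_tube_beta_le hN hk D' hk1 v hv.1 hz₀
    have hΩ : dOmega D D' (blkV1 hN D f).1.2 (β hN D' hk v).1.2
        ≤ dOmega D D' (blkV1 hN D f).1.2 (blkOf D'.toDomains (toBox hN z₀)).1.2 + 3 := by
      have h2 := dOmega_le_add_tdistK D D' (blkV1 hN D f).1.2 (blkOf D'.toDomains (toBox hN z₀)).1.2 (β hN D' hk v).1.2
      linarith
    have hexp : Real.exp (-(δ * dOmega D D' (blkV1 hN D f).1.2 (blkOf D'.toDomains (toBox hN z₀)).1.2))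
        ≤ Real.exp (3 * δ) * Real.exp (-(δ * dOmega D D' (blkV1 hN D f).1.2 (β hN D' hk v).1.2)) := by
      rw [← Real.exp_add, Real.exp_le_exp]
      nlinarith [mul_le_mul_of_nonneg_left hΩ hδ]
    have hCW : 0 ≤ CG * W := mul_nonneg hC hW0
    calc CG * (Φ (blkV1 hN D f) * B)
          * Real.exp (-(δ * min ((geomT D).dist (blkV1 hN D f) ⟨(blkOf D'.toDomains (toBox hN z₀)).1, hzD⟩)
              ((geomT D').dist ⟨(blkV1 hN D f).1, hyD'⟩ (blkOf D'.toDomains (toBox hN z₀)))))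
          * Real.exp (-(δ * dOmega D D' (blkV1 hN D f).1.2 (blkOf D'.toDomains (toBox hN z₀)).1.2))
        ≤ CG * W * 1 * (Real.exp (3 * δ) * Real.exp (-(δ * dOmega D D' (blkV1 hN D f).1.2 (β hN D' hk v).1.2))) :=
          mul_le_mul (mul_le_mul_of_nonneg_left hmin hCW) hexp (Real.exp_pos _).le (mul_nonneg hCW zero_le_one)
      _ = _ := by ring
  -- the decomposition over the met blocks
  have hdec : Td q f = ∑ z, Td (blockPiece (g := geomT D') (blkV1 hN D') z q) f := by
    conv_lhs => rw [← sum_blockPiece (g := geomT D') (blkV1 hN D') q]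
    rw [map_sum, Finset.sum_apply]
  have hTq : T' q f - T q f = Td q f := by
    rw [hTd, LinearMap.sub_apply, Pi.sub_apply]
  have hcard : ((metBlocks hN D' hk v).card : ℝ) ≤ 2 * (((ℓ + 1 : ℕ) : ℝ)) ^ (d + 1) := by
    exact_mod_cast card_metBlocks_le hN D' hk hk1 hRM v
  have hK0 : 0 ≤ CG * W * (Real.exp (3 * δ) * Real.exp (-(δ * dOmega D D' (blkV1 hN D f).1.2 (β hN D' hk v).1.2))) :=
    mul_nonneg (mul_nonneg hC hW0) (mul_nonneg (Real.exp_pos _).le (Real.exp_pos _).le)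
  rw [hTq, hdec]
  calc |∑ z, Td (blockPiece (g := geomT D') (blkV1 hN D') z q) f|
      ≤ ∑ z, |Td (blockPiece (g := geomT D') (blkV1 hN D') z q) f| := Finset.abs_sum_le_sum_abs _ _
    _ = ∑ z ∈ metBlocks hN D' hk v, |Td (blockPiece (g := geomT D') (blkV1 hN D') z q) f| := by
        refine (Finset.sum_subset (Finset.subset_univ (metBlocks hN D' hk v)) fun z _ hz => ?_).symm
        rw [blockPiece_qwt_eq_zero hN D' hk v hz, map_zero, Pi.zero_apply, abs_zero]
    _ ≤ ∑ z ∈ metBlocks hN D' hk v, CG * W * (Real.exp (3 * δ) * Real.exp (-(δ * dOmega D D' (blkV1 hN D f).1.2 (β hN D' hk v).1.2))) :=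
        Finset.sum_le_sum hpiece
    _ = (metBlocks hN D' hk v).card
          * (CG * W * (Real.exp (3 * δ) * Real.exp (-(δ * dOmega D D' (blkV1 hN D f).1.2 (β hN D' hk v).1.2)))) := by
        rw [Finset.sum_const, nsmul_eq_mul]
    _ ≤ (2 * (((ℓ + 1 : ℕ) : ℝ)) ^ (d + 1))
          * (CG * W * (Real.exp (3 * δ) * Real.exp (-(δ * dOmega D D' (blkV1 hN D f).1.2 (β hN D' hk v).1.2)))) :=
        mul_le_mul_of_nonneg_right hcard hK0
    _ = _ := by rw [hW]; ring

end Inside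

/-! ## §4  The surviving terms of the two sums -/

section Terms

variable (hN : ∀ μ, N0 ℓ Mh k P' μ = (PV d ℓ m K hd hL).sitesPerDir 0) (D D' : TDomains d ℓ Mh k P' R) (hk : k ≤ m + K)
variable {cf : ℝ} (hcf : cf ≠ 0) {w : BondIdx (domT hN D hk) → ℝ} (hw : ∀ i, 0 < w i)
  {w' : BondIdx (domT hN D' hk) → ℝ} (hw' : ∀ i, 0 < w' i)

/-- **ONE TERM OF THE FIRST SUM.**  HYPOTHESES (one rate `δ`): a (2.136)-type majorant `A·Φ·e^{−δd_T}` of the left factor `T` of the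
family `{Ω_j}`, the (2.149) entries of `(QGQ*)⁻¹[D]` (`≤ Λ_a⁻¹Λ_b⁻¹·S·e^{−δρ(a,b)}`), the Theorem-3.14 bound of `(QGQ*)⁻¹` on common top
pairs (`hEΔ`, the conclusion shape of file Q3 `thm314_QGQinv_flat_V1`: `≤ C_Q·Λ_i⁻¹Λ′_{i′}⁻¹·e^{−δd(βi, β′i′, Ω)}`) and the (2.60) threshold
`L^{D+2}e^{−½δ(R·L·M_h − 1)} ≤ 1`.  CONCLUSION: for a common top `c`, a fine bond `f` of `Ω` and ANY `u ∈ 𝔅[D]`: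
`|kerE(c,u)·(Tq_u)(f)| ≤ 2L^De^{δ(ℓ+3)}·A·(C_Q + S·L^{D+4})·(Φ(y(f))/pref(y(f)))·e^{δ(ℓ+7)}·e^{−¼δd(y(f), βc, Ω)}·e^{−¼δd_T(y(f), βu)}` —
if `u` is a common top index bond the kernel is the file-Q3 difference and the level factors cancel to the output ratio
(`Λ_uΛ′_c̃ = pref(y)L^{−kD}`); if not, `u` charges `Ωᶜ` within `L + 2` of `βu` (`exists_witness_of_not_isCT`) and the (3.154) factor
is read off the chain `y(f) → βu → βc` after the level absorption of `entry_col_le`.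
[cite: Balaban1985BackgroundPropagators, Thm 3.14 (3.154) pp.426–427; Balaban1984PropagatorsII, (2.150) p.249, (2.149) p.249, (2.136) p.247] -/
theorem abs_kerE_mul_colT_le (hk1 : 1 ≤ k) (hRM : 2 ≤ R * Mh) (hMh : 1 ≤ Mh) (hP : ∀ μ, 1 ≤ P' μ)
    {T : Module.End ℝ (PBond (PV d ℓ m K hd hL) 0 → ℝ)} {Φ : ↥(bset D.toDomains) → ℝ} {A S CQ δ : ℝ}
    (hΦ : ∀ y, 0 ≤ Φ y) (hA : 0 ≤ A) (hS : 0 ≤ S) (hCQ : 0 ≤ CQ) (hδ : 0 ≤ δ)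
    (hT : HasMajorant (g := geomT D) (blkV1 hN D) T (fun y y' => A * Φ y * Real.exp (-(δ * (geomT D).dist y y'))))
    (hE : ∀ a b : BondIdx (domT hN D hk),
      |⟪EuclideanSpace.single a (1 : ℝ), EE (domT hN D hk) hcf hw (EuclideanSpace.single b (1 : ℝ))⟫_ℝ| ≤
        (lam hN D hk cf a)⁻¹ * (lam hN D hk cf b)⁻¹ * (S * Real.exp (-(δ * rho hN D hk a b))))
    (hEΔ : ∀ (i : BondIdx (domT hN D hk)) (hi : IsCT hN D D' hk i.1) (i' : BondIdx (domT hN D' hk))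
        (hi' : IsCT hN D D' hk i'.1),
      |⟪EuclideanSpace.single i (1 : ℝ), EE (domT hN D hk) hcf hw
            (EuclideanSpace.single (⟨i'.1, hi'.2.1⟩ : BondIdx (domT hN D hk)) (1 : ℝ))⟫_ℝ
          - ⟪EuclideanSpace.single (⟨i.1, hi.2.2⟩ : BondIdx (domT hN D' hk)) (1 : ℝ), EE (domT hN D' hk) hcf hw'
            (EuclideanSpace.single i' (1 : ℝ))⟫_ℝ|
        ≤ CQ * ((lam hN D hk cf i)⁻¹ * (lam hN D' hk cf i')⁻¹)
          * Real.exp (-(δ * dOmega D D' (β hN D hk i).1.2 (β hN D' hk i').1.2)))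
    (hsmall : ((ℓ : ℝ) + 1) ^ (d + 3) * Real.exp (-(δ / 2 * ((R : ℝ) * (((ℓ : ℝ) + 1) * Mh) - 1))) ≤ 1)
    (c : BondIdx (domT hN D hk)) (hc : IsCT hN D D' hk c.1) (f : PBond (PV d ℓ m K hd hL) 0)
    (hfD : D.lev (toBox hN f.src).1 = k) (hfD' : D'.lev (toBox hN f.src).1 = k) (u : BondIdx (domT hN D hk)) :
    |kerE hN D D' hk hcf hw hw' c hc u * colT hN D hk T u f|
      ≤ (2 * (((ℓ + 1 : ℕ) : ℝ)) ^ (d + 1) * Real.exp (δ * ((ℓ : ℝ) + 3))) * A * (CQ + S * ((ℓ : ℝ) + 1) ^ (d + 5))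
          * (Φ (blkV1 hN D f) / pref cf (blkV1 hN D f))
          * Real.exp (δ * ((ℓ : ℝ) + 7))
          * Real.exp (-(δ / 4 * dOmega D D' (blkV1 hN D f).1.2 (β hN D hk c).1.2))
          * Real.exp (-(δ / 4 * (geomT D).dist (blkV1 hN D f) (β hN D hk u))) := by
  have hdT := B6Prop23MultiLevelTorus.isPseudoDist_distT D hMh hP
  have hρ := rho_isPseudoDist hN D hk hMh hP
  have hℓ0 : (0 : ℝ) ≤ (ℓ : ℝ) := Nat.cast_nonneg ℓ
  have hL0 : (0 : ℝ) ≤ (ℓ : ℝ) + 1 := by linarith only [hℓ0]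
  have hF : ∀ y : ↥(bset D.toDomains), 0 ≤ A * Φ y := fun y => mul_nonneg hA (hΦ y)
  obtain ⟨hy, hyD', -, -, -⟩ := blkV1_common_top hN D D' f hfD hfD'
  set CG0 : ℝ := 2 * (((ℓ + 1 : ℕ) : ℝ)) ^ (d + 1) * Real.exp (δ * ((ℓ : ℝ) + 3)) with hCG0
  have hCG00 : 0 ≤ CG0 := by positivity
  have hKA : 0 ≤ CG0 * A := mul_nonneg hCG00 hA
  have hp := pref_pos D hcf (blkV1 hN D f)
  have hr0 : 0 ≤ Φ (blkV1 hN D f) / pref cf (blkV1 hN D f) := div_nonneg (hΦ _) hp.le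
  have hd₁0 : 0 ≤ (geomT D).dist (blkV1 hN D f) (β hN D hk u) := distT_nonneg (D := D) _ _
  have hdΩ0 : 0 ≤ dOmega D D' (blkV1 hN D f).1.2 (β hN D hk c).1.2 := dOmega_nonneg D D' _ _
  have hβc : (β hN D hk c).1.1 = k := (beta_level hN D hk hk1 c).trans hc.1
  have hct : tdistK (ℓ := ℓ) (Mh := Mh) (k := k) (P := P') (β hN D' hk ⟨c.1, hc.2.2⟩).1.2 (β hN D hk c).1.2 ≤ 3 := by
    rw [tdistK_comm]; exact tdistK_twin_le hN D D' hk c hc hk1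
  have hrate : δ / 4 ≤ δ / 2 := by linarith only [hδ]
  -- the target constants dominate (light arithmetic, done before the heavy estimates)
  have hKK1 : CQ * CG0 * (A * (Φ (blkV1 hN D f) / pref cf (blkV1 hN D f)))
      ≤ CG0 * A * (CQ + S * ((ℓ : ℝ) + 1) ^ (d + 5)) * (Φ (blkV1 hN D f) / pref cf (blkV1 hN D f)) := by
    have h0 : 0 ≤ CG0 * A * (S * ((ℓ : ℝ) + 1) ^ (d + 5)) * (Φ (blkV1 hN D f) / pref cf (blkV1 hN D f)) :=
      mul_nonneg (mul_nonneg hKA (mul_nonneg hS (pow_nonneg hL0 _))) hr0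
    calc CQ * CG0 * (A * (Φ (blkV1 hN D f) / pref cf (blkV1 hN D f)))
        = CG0 * A * CQ * (Φ (blkV1 hN D f) / pref cf (blkV1 hN D f)) := by ring
      _ ≤ CG0 * A * CQ * (Φ (blkV1 hN D f) / pref cf (blkV1 hN D f))
          + CG0 * A * (S * ((ℓ : ℝ) + 1) ^ (d + 5)) * (Φ (blkV1 hN D f) / pref cf (blkV1 hN D f)) := le_add_of_nonneg_right h0
      _ = _ := by ring
  have hKK2 : A * Φ (blkV1 hN D f) / pref cf (blkV1 hN D f) * S * CG0 * ((ℓ : ℝ) + 1) ^ 2 * ((ℓ : ℝ) + 1) ^ (d + 3)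
      ≤ CG0 * A * (CQ + S * ((ℓ : ℝ) + 1) ^ (d + 5)) * (Φ (blkV1 hN D f) / pref cf (blkV1 hN D f)) := by
    have e : A * Φ (blkV1 hN D f) / pref cf (blkV1 hN D f) * S * CG0 * ((ℓ : ℝ) + 1) ^ 2 * ((ℓ : ℝ) + 1) ^ (d + 3)
        = CG0 * A * (S * ((ℓ : ℝ) + 1) ^ (d + 5)) * (Φ (blkV1 hN D f) / pref cf (blkV1 hN D f)) := by ring
    rw [e]
    exact mul_le_mul_of_nonneg_right (mul_le_mul_of_nonneg_left (le_add_of_nonneg_left hCQ) hKA) hr0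
  have hEE1 : Real.exp (δ / 2 * 3) ≤ Real.exp (δ * ((ℓ : ℝ) + 7)) :=
    Real.exp_le_exp.2 (by linarith only [hδ, mul_nonneg hδ hℓ0])
  have hEE2 : Real.exp (δ / 4 * (2 * (ℓ : ℝ) + 8)) ≤ Real.exp (δ * ((ℓ : ℝ) + 7)) :=
    Real.exp_le_exp.2 (by linarith only [hδ, mul_nonneg hδ hℓ0])
  by_cases hu : IsCT hN D D' hk u.1
  · -- `u` common top: the Theorem-3.14 bound of `(QGQ*)⁻¹` in the kernel, the (2.136)-type bound of the column
    have hβu : (β hN D hk u).1.1 = k := (beta_level hN D hk hk1 u).trans hu.1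
    have hc' : IsCT hN D D' hk (⟨c.1, hc.2.2⟩ : BondIdx (domT hN D' hk)).1 := hc
    have hb0 : 0 ≤ dOmega D D' (β hN D hk u).1.2 (β hN D' hk ⟨c.1, hc.2.2⟩).1.2 := dOmega_nonneg D D' _ _
    -- the (3.154) chain `y(f) → βu → β′c̃ → βc`
    have hΩ : dOmega D D' (blkV1 hN D f).1.2 (β hN D hk c).1.2
        ≤ (geomT D).dist (blkV1 hN D f) (β hN D hk u) + dOmega D D' (β hN D hk u).1.2 (β hN D' hk ⟨c.1, hc.2.2⟩).1.2 + 3 := by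
      have h1 := dOmega_le_tdistK_add D D' (blkV1 hN D f).1.2 (β hN D hk u).1.2 (β hN D hk c).1.2
      have h2 := dOmega_le_add_tdistK D D' (β hN D hk u).1.2 (β hN D' hk ⟨c.1, hc.2.2⟩).1.2 (β hN D hk c).1.2
      have h3 := tdistK_le_distT_of_top D hMh hP hy hβu
      linarith only [h1, h2, h3, hct]
    have hchain := exp_chain (r := δ) hδ hb0 hΩ
    -- the level factors cancel to the output ratio: `Λ_u⁻¹Λ′_c̃⁻¹·(L^{kD})⁻¹·A·Φ(y(f)) = A·Φ(y(f))/pref(y(f))`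
    have hW := pref_mul_volInv_eq hN D hk D D' cf hy u hu.1 ⟨c.1, hc.2.2⟩ hc.1
    have hlu := lam_pos hN D hk hcf u
    have hlc := lam_pos hN D' hk hcf ⟨c.1, hc.2.2⟩
    have hΦp : Φ (blkV1 hN D f) = Φ (blkV1 hN D f) / pref cf (blkV1 hN D f) * pref cf (blkV1 hN D f) :=
      (div_mul_cancel₀ _ hp.ne').symm
    have e : (lam hN D hk cf u)⁻¹ * (lam hN D' hk cf ⟨c.1, hc.2.2⟩)⁻¹
        * (((((ℓ + 1 : ℕ) : ℝ) ^ (d + 1)) ^ k)⁻¹ * (A * Φ (blkV1 hN D f)))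
        = A * (Φ (blkV1 hN D f) / pref cf (blkV1 hN D f)) := by
      rw [hΦp, show ((((ℓ + 1 : ℕ) : ℝ) ^ (d + 1)) ^ k)⁻¹
          * (A * (Φ (blkV1 hN D f) / pref cf (blkV1 hN D f) * pref cf (blkV1 hN D f)))
          = A * (Φ (blkV1 hN D f) / pref cf (blkV1 hN D f))
            * (pref cf (blkV1 hN D f) * ((((ℓ + 1 : ℕ) : ℝ) ^ (d + 1)) ^ k)⁻¹) by ring, hW]
      field_simp
    have hpos : 0 ≤ CQ * ((lam hN D hk cf u)⁻¹ * (lam hN D' hk cf ⟨c.1, hc.2.2⟩)⁻¹)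
        * Real.exp (-(δ * dOmega D D' (β hN D hk u).1.2 (β hN D' hk ⟨c.1, hc.2.2⟩).1.2)) :=
      mul_nonneg (mul_nonneg hCQ (mul_nonneg (inv_nonneg.2 hlu.le) (inv_nonneg.2 hlc.le))) (Real.exp_pos _).le
    have hK0 : 0 ≤ CQ * CG0 * (A * (Φ (blkV1 hN D f) / pref cf (blkV1 hN D f))) :=
      mul_nonneg (mul_nonneg hCQ hCG00) (mul_nonneg hA hr0)
    -- the heavy estimates
    have hker : |kerE hN D D' hk hcf hw hw' c hc u|
        ≤ CQ * ((lam hN D hk cf u)⁻¹ * (lam hN D' hk cf ⟨c.1, hc.2.2⟩)⁻¹)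
          * Real.exp (-(δ * dOmega D D' (β hN D hk u).1.2 (β hN D' hk ⟨c.1, hc.2.2⟩).1.2)) := by
      unfold kerE
      rw [dif_pos hu, ← inner_EE_eq_ent, ← inner_EE_eq_ent]
      exact hEΔ u hu ⟨c.1, hc.2.2⟩ hc'
    have hcol := abs_colT_le hN D hk hk1 hRM hMh hP hF hδ hT u f
    have hlvl : lvl hN D hk u = k := hu.1
    rw [hlvl] at hcol
    have hX : |kerE hN D D' hk hcf hw hw' c hc u * colT hN D hk T u f|
        ≤ CQ * CG0 * (A * (Φ (blkV1 hN D f) / pref cf (blkV1 hN D f)))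
          * (Real.exp (-(δ * (geomT D).dist (blkV1 hN D f) (β hN D hk u)))
            * Real.exp (-(δ * dOmega D D' (β hN D hk u).1.2 (β hN D' hk ⟨c.1, hc.2.2⟩).1.2))) := by
      rw [abs_mul]
      refine (mul_le_mul hker hcol (abs_nonneg _) hpos).trans (le_of_eq ?_)
      calc CQ * ((lam hN D hk cf u)⁻¹ * (lam hN D' hk cf ⟨c.1, hc.2.2⟩)⁻¹)
            * Real.exp (-(δ * dOmega D D' (β hN D hk u).1.2 (β hN D' hk ⟨c.1, hc.2.2⟩).1.2))
            * (CG0 * ((((ℓ + 1 : ℕ) : ℝ) ^ (d + 1)) ^ k)⁻¹ * (A * Φ (blkV1 hN D f))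
              * Real.exp (-(δ * (geomT D).dist (blkV1 hN D f) (β hN D hk u))))
          = CQ * CG0 * ((lam hN D hk cf u)⁻¹ * (lam hN D' hk cf ⟨c.1, hc.2.2⟩)⁻¹
              * (((((ℓ + 1 : ℕ) : ℝ) ^ (d + 1)) ^ k)⁻¹ * (A * Φ (blkV1 hN D f))))
              * (Real.exp (-(δ * (geomT D).dist (blkV1 hN D f) (β hN D hk u)))
                * Real.exp (-(δ * dOmega D D' (β hN D hk u).1.2 (β hN D' hk ⟨c.1, hc.2.2⟩).1.2))) := by ring
        _ = _ := by rw [e]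
    exact final_shape (hX.trans (mul_le_mul_of_nonneg_left hchain hK0)) hK0 hKK1 (Real.exp_pos _).le hEE1
      (Real.exp_pos _).le (exp_rate_mono hrate hdΩ0) (Real.exp_pos _).le (exp_rate_mono hrate hd₁0)
  · -- `u` not common top: (2.149) × (2.136) of one family with the level factors absorbed; `u` charges `Ωᶜ`
    obtain ⟨z, hzΩ, hz⟩ := exists_witness_of_not_isCT hN D D' hk hk1 hRM hMh hP u hu
    have hd₂0 : 0 ≤ rho hN D hk u c := hρ.nonneg u c
    -- the (3.154) chain `y(f) → βu ∋ z → βc`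
    have hΩ : dOmega D D' (blkV1 hN D f).1.2 (β hN D hk c).1.2
        ≤ (geomT D).dist (blkV1 hN D f) (β hN D hk u) + rho hN D hk u c + (2 * (ℓ : ℝ) + 8) := by
      have h0 := dOmega_le D D' (β := (blkV1 hN D f).1.2) (β' := (β hN D hk c).1.2) hzΩ
      have h5 := tdistK_blk_le_of_top D hMh hP z hy
      have h6 := tdistK_blk_le_of_top D hMh hP z hβc
      rw [tdistK_comm] at h5
      have h7 := hdT.triangle (blkOf D.toDomains z) (β hN D hk u) (blkV1 hN D f)
      have h8 := hdT.triangle (blkOf D.toDomains z) (β hN D hk u) (β hN D hk c)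
      have h9 : (geomT D).dist (blkOf D.toDomains z) (β hN D hk u) ≤ (ℓ : ℝ) + 3 := by rw [hdT.symm]; exact hz
      have h10 : (geomT D).dist (β hN D hk u) (blkV1 hN D f) = (geomT D).dist (blkV1 hN D f) (β hN D hk u) :=
        hdT.symm _ _
      have h11 : (geomT D).dist (β hN D hk u) (β hN D hk c) = rho hN D hk u c := rfl
      linarith only [h0, h5, h6, h7, h8, h9, h10, h11]
    have hchain := exp_chain (r := δ / 2) (div_nonneg hδ zero_le_two) hd₂0 hΩ
    rw [show δ / 2 / 2 = δ / 4 by ring] at hchain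
    have hK0 : 0 ≤ A * Φ (blkV1 hN D f) / pref cf (blkV1 hN D f) * S * CG0 * ((ℓ : ℝ) + 1) ^ 2 * ((ℓ : ℝ) + 1) ^ (d + 3) :=
      mul_nonneg (mul_nonneg (mul_nonneg (mul_nonneg (div_nonneg (hF _) hp.le) hS) hCG00) (pow_nonneg hL0 _))
        (pow_nonneg hL0 _)
    have hker : kerE hN D D' hk hcf hw hw' c hc u = ent hN D hk (EE (domT hN D hk) hcf hw) u c := by
      unfold kerE; rw [dif_neg hu, sub_zero]
    -- the heavy estimate
    have hX0 := entry_col_le hN D hk hcf hw hk1 hRM hMh hP hF hS hδ hT hE hsmall u c f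
    rw [abs_mul, hker]
    exact final_shape (hX0.trans (mul_le_mul_of_nonneg_left hchain hK0)) hK0 hKK2 (Real.exp_pos _).le hEE2
      (Real.exp_pos _).le le_rfl (Real.exp_pos _).le le_rfl

/-- **ONE TERM OF THE SECOND SUM.**  HYPOTHESES (one rate `δ`): (2.136)-type majorants `A·Φ·e^{−δd_T}`, `A·Φ′·e^{−δd_T′}` of the left
factors `T`, `T′` of the two families with `Φ′(y′(f)) = Φ(y(f))`, the (2.149) entries of `(QGQ*)⁻¹[D′]`, the Theorem-3.14 bound of
`T − T′` between common top blocks (`hTΔ` with prefactor `C·Φ(y)·B`, the conclusion shape of `B9Thm314GFlatV1Transfer.thm314_G_flat_V1` /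
`thm314_gradG_flat_V1`) and the (2.60) threshold.  CONCLUSION: for a common top `c`, a fine bond `f` of `Ω` and ANY `v ∈ 𝔅[D′]`:
`|(QGQ*)⁻¹[D′](v, c̃)·kerT(f, v)| ≤ S·(2L^D·C + 2L^De^{δ(ℓ+3)}·A·(2 + L^{D+4}))·(Φ(y(f))/pref(y(f)))·e^{δ(ℓ+7)}·e^{−¼δd(y(f), βc, Ω)}·e^{−¼δρ′(c̃, v)}`
— three cases: `v` common top with its tube inside `Ω` (`qdiff_inside_le`, the level factors cancel to the output ratio), `v` common top
with its tube meeting `Ωᶜ` (`exists_bad_site_of_not_inside`: the trivial two-term bound of the kernel, the witness within `3` of `β′v` on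
`T^{(k)}`), `v` not common top (`entry_col_le` in the family `{Ω′_j}`, the witness `exists_witness_of_not_isCT'`).
[cite: Balaban1985BackgroundPropagators, Thm 3.14 (3.154) pp.426–427; Balaban1984PropagatorsII, (2.150) p.249, (2.149) p.249, (2.136) p.247] -/
theorem abs_ent_mul_kerT_le (hk1 : 1 ≤ k) (hRM : 2 ≤ R * Mh) (hMh : 1 ≤ Mh) (hP : ∀ μ, 1 ≤ P' μ)
    {T T' : Module.End ℝ (PBond (PV d ℓ m K hd hL) 0 → ℝ)} {Φ : ↥(bset D.toDomains) → ℝ} {Φ' : ↥(bset D'.toDomains) → ℝ}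
    {A S CG δ : ℝ} (hΦ : ∀ y, 0 ≤ Φ y) (hΦ' : ∀ y, 0 ≤ Φ' y) (hA : 0 ≤ A) (hS : 0 ≤ S) (hCG : 0 ≤ CG) (hδ : 0 ≤ δ)
    (hT : HasMajorant (g := geomT D) (blkV1 hN D) T (fun y y' => A * Φ y * Real.exp (-(δ * (geomT D).dist y y'))))
    (hT' : HasMajorant (g := geomT D') (blkV1 hN D') T' (fun y y' => A * Φ' y * Real.exp (-(δ * (geomT D').dist y y'))))
    (hE' : ∀ a b : BondIdx (domT hN D' hk),
      |⟪EuclideanSpace.single a (1 : ℝ), EE (domT hN D' hk) hcf hw' (EuclideanSpace.single b (1 : ℝ))⟫_ℝ| ≤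
        (lam hN D' hk cf a)⁻¹ * (lam hN D' hk cf b)⁻¹ * (S * Real.exp (-(δ * rho hN D' hk a b))))
    (hTΔ : ∀ (y : ↥(bset D.toDomains)) (hyD' : y.1 ∈ bset D'.toDomains) (y' : ↥(bset D'.toDomains))
        (hy'D : y'.1 ∈ bset D.toDomains), y.1.1 = k → y'.1.1 = k →
        ∀ (μ : PBond (PV d ℓ m K hd hL) 0 → ℝ) (B : ℝ), BlockSupp (g := geomT D') (blkV1 hN D') μ y' B →
        ∀ x : PBond (PV d ℓ m K hd hL) 0, blkV1 hN D x = y →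
          |T μ x - T' μ x|
            ≤ CG * (Φ y * B)
              * Real.exp (-(δ * min ((geomT D).dist y ⟨y'.1, hy'D⟩) ((geomT D').dist ⟨y.1, hyD'⟩ y')))
              * Real.exp (-(δ * dOmega D D' y.1.2 y'.1.2)))
    (hsmall : ((ℓ : ℝ) + 1) ^ (d + 3) * Real.exp (-(δ / 2 * ((R : ℝ) * (((ℓ : ℝ) + 1) * Mh) - 1))) ≤ 1)
    (c : BondIdx (domT hN D hk)) (hc : IsCT hN D D' hk c.1) (f : PBond (PV d ℓ m K hd hL) 0)
    (hfD : D.lev (toBox hN f.src).1 = k) (hfD' : D'.lev (toBox hN f.src).1 = k)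
    (hΦf : Φ' (blkV1 hN D' f) = Φ (blkV1 hN D f)) (v : BondIdx (domT hN D' hk)) :
    |ent hN D' hk (EE (domT hN D' hk) hcf hw') v ⟨c.1, hc.2.2⟩ * kerT hN D D' hk T T' f v|
      ≤ S * (2 * (((ℓ + 1 : ℕ) : ℝ)) ^ (d + 1) * CG
            + (2 * (((ℓ + 1 : ℕ) : ℝ)) ^ (d + 1) * Real.exp (δ * ((ℓ : ℝ) + 3))) * A * (2 + ((ℓ : ℝ) + 1) ^ (d + 5)))
          * (Φ (blkV1 hN D f) / pref cf (blkV1 hN D f))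
          * Real.exp (δ * ((ℓ : ℝ) + 7))
          * Real.exp (-(δ / 4 * dOmega D D' (blkV1 hN D f).1.2 (β hN D hk c).1.2))
          * Real.exp (-(δ / 4 * rho hN D' hk ⟨c.1, hc.2.2⟩ v)) := by
  have hdT := B6Prop23MultiLevelTorus.isPseudoDist_distT D hMh hP
  have hdT' := B6Prop23MultiLevelTorus.isPseudoDist_distT D' hMh hP
  have hρ' := rho_isPseudoDist hN D' hk hMh hP
  have hℓ0 : (0 : ℝ) ≤ (ℓ : ℝ) := Nat.cast_nonneg ℓ
  have hL0 : (0 : ℝ) ≤ (ℓ : ℝ) + 1 := by linarith only [hℓ0]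
  have hF : ∀ y : ↥(bset D.toDomains), 0 ≤ A * Φ y := fun y => mul_nonneg hA (hΦ y)
  have hF' : ∀ y : ↥(bset D'.toDomains), 0 ≤ A * Φ' y := fun y => mul_nonneg hA (hΦ' y)
  obtain ⟨hy, hyD', hy', hy'D, hlab⟩ := blkV1_common_top hN D D' f hfD hfD'
  have hpp := pref_blkV1_eq hN D D' cf f hfD hfD'
  set CG0 : ℝ := 2 * (((ℓ + 1 : ℕ) : ℝ)) ^ (d + 1) * Real.exp (δ * ((ℓ : ℝ) + 3)) with hCG0
  have hCG00 : 0 ≤ CG0 := by positivity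
  set LD : ℝ := 2 * (((ℓ + 1 : ℕ) : ℝ)) ^ (d + 1) with hLD
  have hLD0 : 0 ≤ LD := by positivity
  set V : ℝ := ((((ℓ + 1 : ℕ) : ℝ) ^ (d + 1)) ^ k)⁻¹ with hV
  have hp := pref_pos D hcf (blkV1 hN D f)
  have hr0 : 0 ≤ Φ (blkV1 hN D f) / pref cf (blkV1 hN D f) := div_nonneg (hΦ _) hp.le
  have hdΩ0 : 0 ≤ dOmega D D' (blkV1 hN D f).1.2 (β hN D hk c).1.2 := dOmega_nonneg D D' _ _
  have ha0 : 0 ≤ rho hN D' hk ⟨c.1, hc.2.2⟩ v := hρ'.nonneg _ _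
  have haa : rho hN D' hk v ⟨c.1, hc.2.2⟩ = rho hN D' hk ⟨c.1, hc.2.2⟩ v := hρ'.symm _ _
  have hβc : (β hN D hk c).1.1 = k := (beta_level hN D hk hk1 c).trans hc.1
  have hβc' : (β hN D' hk ⟨c.1, hc.2.2⟩).1.1 = k := (beta_level hN D' hk hk1 _).trans hc.1
  have hct : tdistK (ℓ := ℓ) (Mh := Mh) (k := k) (P := P') (β hN D' hk ⟨c.1, hc.2.2⟩).1.2 (β hN D hk c).1.2 ≤ 3 := by
    rw [tdistK_comm]; exact tdistK_twin_le hN D D' hk c hc hk1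
  have hrate : δ / 4 ≤ δ / 2 := by linarith only [hδ]
  have hlc := lam_pos hN D' hk hcf ⟨c.1, hc.2.2⟩
  have hlv := lam_pos hN D' hk hcf v
  have hpy : pref cf (blkV1 hN D f) = ((((ℓ + 1 : ℕ) : ℝ)) ^ k / cf) ^ 2 := by
    change ((((ℓ + 1 : ℕ) : ℝ)) ^ (blkV1 hN D f).1.1 / cf) ^ 2 = _; rw [hy]
  -- the target constant dominates the three cases (light arithmetic)
  set K' : ℝ := S * (LD * CG + CG0 * A * (2 + ((ℓ : ℝ) + 1) ^ (d + 5))) * (Φ (blkV1 hN D f) / pref cf (blkV1 hN D f)) with hK'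
  have hK'1 : S * (LD * CG) * (Φ (blkV1 hN D f) / pref cf (blkV1 hN D f)) ≤ K' := by
    rw [hK']
    refine mul_le_mul_of_nonneg_right ?_ hr0
    exact mul_le_mul_of_nonneg_left (le_add_of_nonneg_right
      (mul_nonneg (mul_nonneg hCG00 hA) (add_nonneg zero_le_two (pow_nonneg hL0 _)))) hS
  have hK'2 : S * CG0 * A * 2 * (Φ (blkV1 hN D f) / pref cf (blkV1 hN D f)) ≤ K' := by
    have e : S * CG0 * A * 2 * (Φ (blkV1 hN D f) / pref cf (blkV1 hN D f))
        = S * (CG0 * A * 2) * (Φ (blkV1 hN D f) / pref cf (blkV1 hN D f)) := by ring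
    rw [hK', e]
    refine mul_le_mul_of_nonneg_right (mul_le_mul_of_nonneg_left ?_ hS) hr0
    have h1 : CG0 * A * 2 ≤ CG0 * A * (2 + ((ℓ : ℝ) + 1) ^ (d + 5)) :=
      mul_le_mul_of_nonneg_left (le_add_of_nonneg_right (pow_nonneg hL0 _)) (mul_nonneg hCG00 hA)
    linarith only [h1, mul_nonneg hLD0 hCG]
  have hK'3 : A * Φ (blkV1 hN D f) / pref cf (blkV1 hN D f) * S * CG0 * ((ℓ : ℝ) + 1) ^ 2 * ((ℓ : ℝ) + 1) ^ (d + 3) ≤ K' := by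
    have e : A * Φ (blkV1 hN D f) / pref cf (blkV1 hN D f) * S * CG0 * ((ℓ : ℝ) + 1) ^ 2 * ((ℓ : ℝ) + 1) ^ (d + 3)
        = S * (CG0 * A * ((ℓ : ℝ) + 1) ^ (d + 5)) * (Φ (blkV1 hN D f) / pref cf (blkV1 hN D f)) := by ring
    rw [hK', e]
    refine mul_le_mul_of_nonneg_right (mul_le_mul_of_nonneg_left ?_ hS) hr0
    have h1 : CG0 * A * ((ℓ : ℝ) + 1) ^ (d + 5) ≤ CG0 * A * (2 + ((ℓ : ℝ) + 1) ^ (d + 5)) :=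
      mul_le_mul_of_nonneg_left (le_add_of_nonneg_left zero_le_two) (mul_nonneg hCG00 hA)
    linarith only [h1, mul_nonneg hLD0 hCG]
  have hEE1 : Real.exp (3 * δ) * Real.exp (δ / 2 * 3) ≤ Real.exp (δ * ((ℓ : ℝ) + 7)) := by
    rw [← Real.exp_add, Real.exp_le_exp]; linarith only [hδ, mul_nonneg hδ hℓ0]
  have hEE2 : Real.exp (δ / 2 * 12) ≤ Real.exp (δ * ((ℓ : ℝ) + 7)) := Real.exp_le_exp.2 (by linarith only [hδ, mul_nonneg hδ hℓ0])
  have hEE3 : Real.exp (δ / 4 * (2 * (ℓ : ℝ) + 11)) ≤ Real.exp (δ * ((ℓ : ℝ) + 7)) :=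
    Real.exp_le_exp.2 (by linarith only [hδ, mul_nonneg hδ hℓ0])
  have hpos0 : 0 ≤ (lam hN D' hk cf v)⁻¹ * (lam hN D' hk cf ⟨c.1, hc.2.2⟩)⁻¹
      * (S * Real.exp (-(δ * rho hN D' hk ⟨c.1, hc.2.2⟩ v))) :=
    mul_nonneg (mul_nonneg (inv_nonneg.2 hlv.le) (inv_nonneg.2 hlc.le)) (mul_nonneg hS (Real.exp_pos _).le)
  by_cases hv : IsCT hN D D' hk v.1
  · have hβv : (β hN D' hk v).1.1 = k := (beta_level hN D' hk hk1 v).trans hv.1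
    have hβvD : (β hN D hk ⟨v.1, hv.2.1⟩).1.1 = k := (beta_level hN D hk hk1 _).trans hv.1
    have hvc : tdistK (ℓ := ℓ) (Mh := Mh) (k := k) (P := P') (β hN D' hk v).1.2 (β hN D' hk ⟨c.1, hc.2.2⟩).1.2
        ≤ rho hN D' hk ⟨c.1, hc.2.2⟩ v := by
      rw [← haa]; exact tdistK_le_rho_of_top hN hk D' hMh hP hk1 v ⟨c.1, hc.2.2⟩ hv.1 hc.1
    have hW : ((((ℓ + 1 : ℕ) : ℝ)) ^ k / cf) ^ 2 * V = lam hN D' hk cf v * lam hN D' hk cf ⟨c.1, hc.2.2⟩ :=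
      (lam_mul_lam_of_top hN D' D' hk cf v hv.1 ⟨c.1, hc.2.2⟩ hc.1).symm
    have hVW : V * pref cf (blkV1 hN D f) = lam hN D' hk cf v * lam hN D' hk cf ⟨c.1, hc.2.2⟩ := by
      rw [← hW, hpy, mul_comm]
    -- the level factors cancel to the output ratio
    have e : (lam hN D' hk cf v)⁻¹ * (lam hN D' hk cf ⟨c.1, hc.2.2⟩)⁻¹ * (Φ (blkV1 hN D f) * V)
        = Φ (blkV1 hN D f) / pref cf (blkV1 hN D f) := by
      have hV' : V = lam hN D' hk cf v * lam hN D' hk cf ⟨c.1, hc.2.2⟩ / pref cf (blkV1 hN D f) := by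
        rw [← hVW]; field_simp
      rw [hV']; field_simp
    -- the outer leg (the first heavy hypothesis)
    have hent : |ent hN D' hk (EE (domT hN D' hk) hcf hw') v ⟨c.1, hc.2.2⟩|
        ≤ (lam hN D' hk cf v)⁻¹ * (lam hN D' hk cf ⟨c.1, hc.2.2⟩)⁻¹ * (S * Real.exp (-(δ * rho hN D' hk ⟨c.1, hc.2.2⟩ v))) := by
      rw [← inner_EE_eq_ent, ← haa]; exact hE' v ⟨c.1, hc.2.2⟩
    rcases Classical.em ((v.1.2.src ∈ (domT hN D' hk).Om (lvl hN D' hk v) ∧ v.1.2.src ∈ (domT hN D hk).Om (lvl hN D' hk v)) ∧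
        (v.1.2.tgt ∈ (domT hN D' hk).Om (lvl hN D' hk v) ∧ v.1.2.tgt ∈ (domT hN D hk).Om (lvl hN D' hk v))) with hin | hin
    · -- `v` common top, tube inside `Ω`: the two-family bound of `(T − T′)q′_v` block by block
      have hb0 : 0 ≤ dOmega D D' (blkV1 hN D f).1.2 (β hN D' hk v).1.2 := dOmega_nonneg D D' _ _
      -- the chain `y(f) ⇝ β′v → β′c̃ → βc`
      have hΩ : dOmega D D' (blkV1 hN D f).1.2 (β hN D hk c).1.2
          ≤ rho hN D' hk ⟨c.1, hc.2.2⟩ v + dOmega D D' (blkV1 hN D f).1.2 (β hN D' hk v).1.2 + 3 := by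
        have h2 := dOmega_le_add_tdistK D D' (blkV1 hN D f).1.2 (β hN D' hk v).1.2 (β hN D hk c).1.2
        have h3 := tdistK_triangle (ℓ := ℓ) (Mh := Mh) (k := k) (P := P') (β hN D' hk v).1.2
          (β hN D' hk ⟨c.1, hc.2.2⟩).1.2 (β hN D hk c).1.2
        linarith only [h2, h3, hvc, hct]
      have hchain := exp_chain (r := δ) hδ hb0 hΩ
      have hK0 : 0 ≤ S * (LD * CG) * (Φ (blkV1 hN D f) / pref cf (blkV1 hN D f)) * Real.exp (3 * δ) :=
        mul_nonneg (mul_nonneg (mul_nonneg hS (mul_nonneg hLD0 hCG)) hr0) (Real.exp_pos _).le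
      -- the heavy estimates
      have hq := qdiff_inside_le hN D D' hk hk1 hRM hMh hP hΦ hCG hδ hTΔ v hv hin.1.1 hin.2.1 hin.1.2 hin.2.2 f hfD hfD'
      have hker : |kerT hN D D' hk T T' f v|
          ≤ LD * CG * Real.exp (3 * δ) * (Φ (blkV1 hN D f) * V)
            * Real.exp (-(δ * dOmega D D' (blkV1 hN D f).1.2 (β hN D' hk v).1.2)) := by
        unfold kerT
        rw [dif_pos hv, colT_eq, colT_eq, qwt_twin' hN D D' hk v hv, abs_sub_comm]
        exact hq
      have hX : |ent hN D' hk (EE (domT hN D' hk) hcf hw') v ⟨c.1, hc.2.2⟩ * kerT hN D D' hk T T' f v|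
          ≤ S * (LD * CG) * (Φ (blkV1 hN D f) / pref cf (blkV1 hN D f)) * Real.exp (3 * δ)
            * (Real.exp (-(δ * rho hN D' hk ⟨c.1, hc.2.2⟩ v))
              * Real.exp (-(δ * dOmega D D' (blkV1 hN D f).1.2 (β hN D' hk v).1.2))) := by
        rw [abs_mul]
        refine (mul_le_mul hent hker (abs_nonneg _) hpos0).trans (le_of_eq ?_)
        calc (lam hN D' hk cf v)⁻¹ * (lam hN D' hk cf ⟨c.1, hc.2.2⟩)⁻¹ * (S * Real.exp (-(δ * rho hN D' hk ⟨c.1, hc.2.2⟩ v)))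
              * (LD * CG * Real.exp (3 * δ) * (Φ (blkV1 hN D f) * V)
                * Real.exp (-(δ * dOmega D D' (blkV1 hN D f).1.2 (β hN D' hk v).1.2)))
            = S * (LD * CG) * ((lam hN D' hk cf v)⁻¹ * (lam hN D' hk cf ⟨c.1, hc.2.2⟩)⁻¹ * (Φ (blkV1 hN D f) * V))
                * Real.exp (3 * δ)
                * (Real.exp (-(δ * rho hN D' hk ⟨c.1, hc.2.2⟩ v))
                  * Real.exp (-(δ * dOmega D D' (blkV1 hN D f).1.2 (β hN D' hk v).1.2))) := by ring
          _ = _ := by rw [e]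
      have hX3 : |ent hN D' hk (EE (domT hN D' hk) hcf hw') v ⟨c.1, hc.2.2⟩ * kerT hN D D' hk T T' f v|
          ≤ S * (LD * CG) * (Φ (blkV1 hN D f) / pref cf (blkV1 hN D f)) * ((Real.exp (3 * δ) * Real.exp (δ / 2 * 3))
            * Real.exp (-(δ / 2 * dOmega D D' (blkV1 hN D f).1.2 (β hN D hk c).1.2))
            * Real.exp (-(δ / 2 * rho hN D' hk ⟨c.1, hc.2.2⟩ v))) := by
        refine (hX.trans (mul_le_mul_of_nonneg_left hchain hK0)).trans (le_of_eq ?_); ring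
      exact final_shape hX3 (mul_nonneg (mul_nonneg hS (mul_nonneg hLD0 hCG)) hr0) hK'1
        (mul_nonneg (Real.exp_pos _).le (Real.exp_pos _).le)
        hEE1 (Real.exp_pos _).le (exp_rate_mono hrate hdΩ0) (Real.exp_pos _).le (exp_rate_mono hrate ha0)
    · -- `v` common top, tube meeting `Ωᶜ`: the trivial two-term bound; the witness within `3` of `β′v`
      obtain ⟨z, hz, hbad⟩ := exists_bad_site_of_not_inside hN hk D' D hk1 v hv.1 hin
      have hwl : blk ((ℓ + 1) ^ k) (toBox hN z).1 ∈ OmegaC D D' :=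
        blk_mem_OmegaC D D' (x := toBox hN z) (fun hh => hbad ⟨hh.2, hh.1⟩)
      have h3 : tdistK (ℓ := ℓ) (Mh := Mh) (k := k) (P := P') (blk ((ℓ + 1) ^ k) (toBox hN z).1) (β hN D' hk v).1.2 ≤ 3 :=
        tdistK_tube_beta_le hN hk D' hk1 v hv.1 hz
      have hdD0 : 0 ≤ (geomT D).dist (blkV1 hN D f) (β hN D hk ⟨v.1, hv.2.1⟩) := distT_nonneg (D := D) _ _
      have hdD'0 : 0 ≤ (geomT D').dist (blkV1 hN D' f) (β hN D' hk v) := distT_nonneg (D := D') _ _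
      -- the chains `y(f) → βv_D ~ β′v ∋ wl → β′c̃ → βc` and `y′(f) → β′v ∋ wl → β′c̃ → βc`
      have h0 := dOmega_le D D' (β := (blkV1 hN D f).1.2) (β' := (β hN D hk c).1.2) hwl
      have t5 : tdistK (ℓ := ℓ) (Mh := Mh) (k := k) (P := P') (β hN D' hk v).1.2 (blk ((ℓ + 1) ^ k) (toBox hN z).1) ≤ 3 := by
        rw [tdistK_comm]; exact h3
      have t6 := tdistK_triangle (ℓ := ℓ) (Mh := Mh) (k := k) (P := P') (blk ((ℓ + 1) ^ k) (toBox hN z).1)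
        (β hN D' hk v).1.2 (β hN D hk c).1.2
      have t7 := tdistK_triangle (ℓ := ℓ) (Mh := Mh) (k := k) (P := P') (β hN D' hk v).1.2
        (β hN D' hk ⟨c.1, hc.2.2⟩).1.2 (β hN D hk c).1.2
      have hΩ1 : dOmega D D' (blkV1 hN D f).1.2 (β hN D hk c).1.2
          ≤ rho hN D' hk ⟨c.1, hc.2.2⟩ v + (geomT D).dist (blkV1 hN D f) (β hN D hk ⟨v.1, hv.2.1⟩) + 12 := by
        have t1 := tdistK_triangle (ℓ := ℓ) (Mh := Mh) (k := k) (P := P') (blkV1 hN D f).1.2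
          (β hN D hk ⟨v.1, hv.2.1⟩).1.2 (blk ((ℓ + 1) ^ k) (toBox hN z).1)
        have t2 := tdistK_triangle (ℓ := ℓ) (Mh := Mh) (k := k) (P := P') (β hN D hk ⟨v.1, hv.2.1⟩).1.2
          (β hN D' hk v).1.2 (blk ((ℓ + 1) ^ k) (toBox hN z).1)
        have t3 := tdistK_le_distT_of_top D hMh hP hy hβvD
        have t4 := tdistK_twin_le' hN D D' hk v hv hk1
        linarith only [h0, t1, t2, t3, t4, t5, t6, t7, h3, hvc, hct]
      have hΩ2 : dOmega D D' (blkV1 hN D f).1.2 (β hN D hk c).1.2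
          ≤ rho hN D' hk ⟨c.1, hc.2.2⟩ v + (geomT D').dist (blkV1 hN D' f) (β hN D' hk v) + 12 := by
        have t1 := tdistK_triangle (ℓ := ℓ) (Mh := Mh) (k := k) (P := P') (blkV1 hN D f).1.2 (β hN D' hk v).1.2
          (blk ((ℓ + 1) ^ k) (toBox hN z).1)
        have t3 : tdistK (ℓ := ℓ) (Mh := Mh) (k := k) (P := P') (blkV1 hN D f).1.2 (β hN D' hk v).1.2
            ≤ (geomT D').dist (blkV1 hN D' f) (β hN D' hk v) := by
          rw [← hlab]; exact tdistK_le_distT_of_top D' hMh hP hy' hβv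
        linarith only [h0, t1, t3, t5, t6, t7, h3, hvc, hct]
      have hc1 := exp_chain (r := δ) hδ hdD0 hΩ1
      have hc2 := exp_chain (r := δ) hδ hdD'0 hΩ2
      have hK0 : 0 ≤ S * CG0 * A * (Φ (blkV1 hN D f) / pref cf (blkV1 hN D f)) :=
        mul_nonneg (mul_nonneg (mul_nonneg hS hCG00) hA) hr0
      -- the heavy estimates
      have hcolD := abs_colT_le hN D hk hk1 hRM hMh hP hF hδ hT ⟨v.1, hv.2.1⟩ f
      have hcolD' := abs_colT_le hN D' hk hk1 hRM hMh hP hF' hδ hT' v f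
      have hl1 : lvl hN D hk ⟨v.1, hv.2.1⟩ = k := hv.1
      have hl2 : lvl hN D' hk v = k := hv.1
      rw [hl1] at hcolD
      rw [hl2, hΦf] at hcolD'
      have hker : |kerT hN D D' hk T T' f v|
          ≤ CG0 * V * (A * Φ (blkV1 hN D f)) * Real.exp (-(δ * (geomT D).dist (blkV1 hN D f) (β hN D hk ⟨v.1, hv.2.1⟩)))
            + CG0 * V * (A * Φ (blkV1 hN D f)) * Real.exp (-(δ * (geomT D').dist (blkV1 hN D' f) (β hN D' hk v))) := by
        unfold kerT
        rw [dif_pos hv]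
        exact (abs_sub _ _).trans (add_le_add hcolD hcolD')
      have hX : |ent hN D' hk (EE (domT hN D' hk) hcf hw') v ⟨c.1, hc.2.2⟩ * kerT hN D D' hk T T' f v|
          ≤ S * CG0 * A * (Φ (blkV1 hN D f) / pref cf (blkV1 hN D f))
            * (Real.exp (-(δ * rho hN D' hk ⟨c.1, hc.2.2⟩ v))
              * Real.exp (-(δ * (geomT D).dist (blkV1 hN D f) (β hN D hk ⟨v.1, hv.2.1⟩)))
            + Real.exp (-(δ * rho hN D' hk ⟨c.1, hc.2.2⟩ v))
              * Real.exp (-(δ * (geomT D').dist (blkV1 hN D' f) (β hN D' hk v)))) := by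
        rw [abs_mul]
        refine (mul_le_mul hent hker (abs_nonneg _) hpos0).trans (le_of_eq ?_)
        calc (lam hN D' hk cf v)⁻¹ * (lam hN D' hk cf ⟨c.1, hc.2.2⟩)⁻¹ * (S * Real.exp (-(δ * rho hN D' hk ⟨c.1, hc.2.2⟩ v)))
              * (CG0 * V * (A * Φ (blkV1 hN D f))
                  * Real.exp (-(δ * (geomT D).dist (blkV1 hN D f) (β hN D hk ⟨v.1, hv.2.1⟩)))
                + CG0 * V * (A * Φ (blkV1 hN D f))
                  * Real.exp (-(δ * (geomT D').dist (blkV1 hN D' f) (β hN D' hk v))))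
            = S * CG0 * A * ((lam hN D' hk cf v)⁻¹ * (lam hN D' hk cf ⟨c.1, hc.2.2⟩)⁻¹ * (Φ (blkV1 hN D f) * V))
                * (Real.exp (-(δ * rho hN D' hk ⟨c.1, hc.2.2⟩ v))
                    * Real.exp (-(δ * (geomT D).dist (blkV1 hN D f) (β hN D hk ⟨v.1, hv.2.1⟩)))
                  + Real.exp (-(δ * rho hN D' hk ⟨c.1, hc.2.2⟩ v))
                    * Real.exp (-(δ * (geomT D').dist (blkV1 hN D' f) (β hN D' hk v)))) := by ring
          _ = _ := by rw [e]
      have hX2 : |ent hN D' hk (EE (domT hN D' hk) hcf hw') v ⟨c.1, hc.2.2⟩ * kerT hN D D' hk T T' f v|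
          ≤ S * CG0 * A * 2 * (Φ (blkV1 hN D f) / pref cf (blkV1 hN D f)) * (Real.exp (δ / 2 * 12)
            * Real.exp (-(δ / 2 * dOmega D D' (blkV1 hN D f).1.2 (β hN D hk c).1.2))
            * Real.exp (-(δ / 2 * rho hN D' hk ⟨c.1, hc.2.2⟩ v))) := by
        refine (hX.trans (mul_le_mul_of_nonneg_left (add_le_add hc1 hc2) hK0)).trans (le_of_eq ?_)
        ring
      exact final_shape hX2 (mul_nonneg (mul_nonneg (mul_nonneg (mul_nonneg hS hCG00) hA) zero_le_two) hr0) hK'2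
        (Real.exp_pos _).le hEE2 (Real.exp_pos _).le
        (exp_rate_mono hrate hdΩ0) (Real.exp_pos _).le (exp_rate_mono hrate ha0)
  · -- `v` not common top: one family `{Ω′_j}` with the level factors absorbed; `v` charges `Ωᶜ`
    obtain ⟨z, hzΩ, hz⟩ := exists_witness_of_not_isCT' hN D D' hk hk1 hRM hMh hP v hv
    have hdD'0 : 0 ≤ (geomT D').dist (blkV1 hN D' f) (β hN D' hk v) := distT_nonneg (D := D') _ _
    -- the chain `y′(f) → β′v ∋ z → β′c̃ → βc`
    have hΩ : dOmega D D' (blkV1 hN D f).1.2 (β hN D hk c).1.2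
        ≤ (geomT D').dist (blkV1 hN D' f) (β hN D' hk v) + rho hN D' hk ⟨c.1, hc.2.2⟩ v + (2 * (ℓ : ℝ) + 11) := by
      have h0 := dOmega_le D D' (β := (blkV1 hN D f).1.2) (β' := (β hN D hk c).1.2) hzΩ
      have h5 := tdistK_blk_le_of_top D' hMh hP z hy'
      rw [hlab, tdistK_comm] at h5
      have h6 := tdistK_blk_le_of_top D' hMh hP z hβc'
      have t := tdistK_triangle (ℓ := ℓ) (Mh := Mh) (k := k) (P := P') (blk ((ℓ + 1) ^ k) z.1)
        (β hN D' hk ⟨c.1, hc.2.2⟩).1.2 (β hN D hk c).1.2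
      have h7 := hdT'.triangle (blkOf D'.toDomains z) (β hN D' hk v) (blkV1 hN D' f)
      have h8 := hdT'.triangle (blkOf D'.toDomains z) (β hN D' hk v) (β hN D' hk ⟨c.1, hc.2.2⟩)
      have h9 : (geomT D').dist (blkOf D'.toDomains z) (β hN D' hk v) ≤ (ℓ : ℝ) + 3 := by rw [hdT'.symm]; exact hz
      have h10 : (geomT D').dist (β hN D' hk v) (blkV1 hN D' f) = (geomT D').dist (blkV1 hN D' f) (β hN D' hk v) :=
        hdT'.symm _ _
      have h11 : (geomT D').dist (β hN D' hk v) (β hN D' hk ⟨c.1, hc.2.2⟩) = rho hN D' hk ⟨c.1, hc.2.2⟩ v := haa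
      linarith only [h0, h5, h6, t, h7, h8, h9, h10, h11, hct]
    have hchain := exp_chain' (r := δ / 2) (div_nonneg hδ zero_le_two) hdD'0 hΩ
    rw [show δ / 2 / 2 = δ / 4 by ring] at hchain
    have hK0 : 0 ≤ A * Φ (blkV1 hN D f) / pref cf (blkV1 hN D f) * S * CG0 * ((ℓ : ℝ) + 1) ^ 2 * ((ℓ : ℝ) + 1) ^ (d + 3) :=
      mul_nonneg (mul_nonneg (mul_nonneg (mul_nonneg (div_nonneg (hF _) hp.le) hS) hCG00) (pow_nonneg hL0 _))
        (pow_nonneg hL0 _)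
    have hker : kerT hN D D' hk T T' f v = -colT hN D' hk T' v f := by
      unfold kerT; rw [dif_neg hv, zero_sub]
    -- the heavy estimate
    have hX0 := entry_col_le hN D' hk hcf hw' hk1 hRM hMh hP hF' hS hδ hT' hE' hsmall v ⟨c.1, hc.2.2⟩ f
    rw [haa, hΦf, hpp] at hX0
    rw [abs_mul, hker, abs_neg]
    exact final_shape (hX0.trans (mul_le_mul_of_nonneg_left hchain hK0)) hK0 hK'3 (Real.exp_pos _).le hEE3
      (Real.exp_pos _).le le_rfl (Real.exp_pos _).le le_rfl

end Terms

/-! ## §5  The two sums: the fibre sum over the carrier blocks and (2.61) -/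

section Sum

variable (hN : ∀ μ, N0 ℓ Mh k P' μ = (PV d ℓ m K hd hL).sitesPerDir 0) (D D' : TDomains d ℓ Mh k P' R) (hk : k ≤ m + K)
variable {cf : ℝ} (hcf : cf ≠ 0) {w : BondIdx (domT hN D hk) → ℝ} (hw : ∀ i, 0 < w i)
  {w' : BondIdx (domT hN D' hk) → ℝ} (hw' : ∀ i, 0 < w' i)

/-- **(2.61) OVER THE INDEX BONDS, CENTRED AT A BLOCK**: `Σ_{u∈𝔅[D₀]} e^{−¼δd_T(y, βu)} ≤ 2D·K_s` from `Σ_{y′} e^{−¼δd_T(y,y′)} ≤ K_s`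
(at most `2D` index bonds per carrier block, r03's `sum_comp_beta_le`). [cite: Balaban1984PropagatorsII, Lemma 2.1 (2.61) p.234, (2.45) p.231] -/
theorem sum_exp_dist_beta_le (D₀ : TDomains d ℓ Mh k P' R) (hk1 : 1 ≤ k) {Ks δ : ℝ}
    (h261 : Ineq261With Ks (geomT D₀) δ (1 / 4)) (y : ↥(bset D₀.toDomains)) :
    ∑ u : BondIdx (domT hN D₀ hk), Real.exp (-(δ / 4 * (geomT D₀).dist y (β hN D₀ hk u))) ≤ 2 * ((d : ℝ) + 1) * Ks := by
  have hfib := sum_comp_beta_le hN D₀ hk hk1 (g := fun y'' => Real.exp (-(δ / 4 * (geomT D₀).dist y y'')))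
    (fun _ => (Real.exp_pos _).le)
  have h' : ∑ y'' : ↥(bset D₀.toDomains), Real.exp (-(δ / 4 * (geomT D₀).dist y y'')) ≤ Ks := by
    have h := h261 y
    refine le_trans (le_of_eq (Finset.sum_congr rfl fun y'' _ => ?_)) h
    rw [show δ / 4 * (geomT D₀).dist y y'' = 1 / 4 * δ * (geomT D₀).dist y y'' by ring]
  exact hfib.trans (mul_le_mul_of_nonneg_left h' (by positivity))

/-- **(2.61) OVER THE INDEX BONDS, CENTRED AT AN INDEX BOND**: `Σ_{v∈𝔅[D₀]} e^{−¼δρ(a, v)} ≤ 2D·K_s`.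
[cite: Balaban1984PropagatorsII, Lemma 2.1 (2.61) p.234, (2.45) p.231] -/
theorem sum_exp_rho_le' (D₀ : TDomains d ℓ Mh k P' R) (hk1 : 1 ≤ k) {Ks δ : ℝ}
    (h261 : Ineq261With Ks (geomT D₀) δ (1 / 4)) (a : BondIdx (domT hN D₀ hk)) :
    ∑ v : BondIdx (domT hN D₀ hk), Real.exp (-(δ / 4 * rho hN D₀ hk a v)) ≤ 2 * ((d : ℝ) + 1) * Ks :=
  sum_exp_dist_beta_le hN hk D₀ hk1 h261 (β hN D₀ hk a)

/-- **THEOREM 3.14 FOR `TQ*(QGQ*)⁻¹` AT `U = 1`, THE `Ω`-BOUND (hypothesis level)**: under the hypotheses of `abs_kerE_mul_colT_le` and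
`abs_ent_mul_kerT_le` and the (2.61) profiles of both families (`Σ_{y′} e^{−¼δd_T(y,y′)} ≤ K_s`), for a common top `c` and a fine
bond `f` of `Ω`:
`|(TQ*Ee_c)(f) − (T′Q′*E′e_c̃)(f)| ≤ 2D·(K₁K_s + K₂K_s′)·(Φ(y(f))/pref(y(f)))·e^{δ(ℓ+7)}·e^{−¼δ·d(y(f), βc, Ω)}` with the constants
`K₁`, `K₂` of §4. [cite: Balaban1985BackgroundPropagators, Thm 3.14 (3.154) pp.426–427; Balaban1984PropagatorsII, Cor. 2.8 (2.150)–(2.151) p.249, Lemma 2.1 (2.61) p.234] -/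
theorem TH_sub_omega_le (hk1 : 1 ≤ k) (hRM : 2 ≤ R * Mh) (hMh : 1 ≤ Mh) (hP : ∀ μ, 1 ≤ P' μ)
    {T T' : Module.End ℝ (PBond (PV d ℓ m K hd hL) 0 → ℝ)} {Φ : ↥(bset D.toDomains) → ℝ} {Φ' : ↥(bset D'.toDomains) → ℝ}
    {A S CQ CG δ Ks Ks' : ℝ} (hΦ : ∀ y, 0 ≤ Φ y) (hΦ' : ∀ y, 0 ≤ Φ' y) (hA : 0 ≤ A) (hS : 0 ≤ S) (hCQ : 0 ≤ CQ) (hCG : 0 ≤ CG)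
    (hδ : 0 ≤ δ)
    (hT : HasMajorant (g := geomT D) (blkV1 hN D) T (fun y y' => A * Φ y * Real.exp (-(δ * (geomT D).dist y y'))))
    (hT' : HasMajorant (g := geomT D') (blkV1 hN D') T' (fun y y' => A * Φ' y * Real.exp (-(δ * (geomT D').dist y y'))))
    (hE : ∀ a b : BondIdx (domT hN D hk),
      |⟪EuclideanSpace.single a (1 : ℝ), EE (domT hN D hk) hcf hw (EuclideanSpace.single b (1 : ℝ))⟫_ℝ| ≤
        (lam hN D hk cf a)⁻¹ * (lam hN D hk cf b)⁻¹ * (S * Real.exp (-(δ * rho hN D hk a b))))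
    (hE' : ∀ a b : BondIdx (domT hN D' hk),
      |⟪EuclideanSpace.single a (1 : ℝ), EE (domT hN D' hk) hcf hw' (EuclideanSpace.single b (1 : ℝ))⟫_ℝ| ≤
        (lam hN D' hk cf a)⁻¹ * (lam hN D' hk cf b)⁻¹ * (S * Real.exp (-(δ * rho hN D' hk a b))))
    (hEΔ : ∀ (i : BondIdx (domT hN D hk)) (hi : IsCT hN D D' hk i.1) (i' : BondIdx (domT hN D' hk))
        (hi' : IsCT hN D D' hk i'.1),
      |⟪EuclideanSpace.single i (1 : ℝ), EE (domT hN D hk) hcf hw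
            (EuclideanSpace.single (⟨i'.1, hi'.2.1⟩ : BondIdx (domT hN D hk)) (1 : ℝ))⟫_ℝ
          - ⟪EuclideanSpace.single (⟨i.1, hi.2.2⟩ : BondIdx (domT hN D' hk)) (1 : ℝ), EE (domT hN D' hk) hcf hw'
            (EuclideanSpace.single i' (1 : ℝ))⟫_ℝ|
        ≤ CQ * ((lam hN D hk cf i)⁻¹ * (lam hN D' hk cf i')⁻¹)
          * Real.exp (-(δ * dOmega D D' (β hN D hk i).1.2 (β hN D' hk i').1.2)))
    (hTΔ : ∀ (y : ↥(bset D.toDomains)) (hyD' : y.1 ∈ bset D'.toDomains) (y' : ↥(bset D'.toDomains))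
        (hy'D : y'.1 ∈ bset D.toDomains), y.1.1 = k → y'.1.1 = k →
        ∀ (μ : PBond (PV d ℓ m K hd hL) 0 → ℝ) (B : ℝ), BlockSupp (g := geomT D') (blkV1 hN D') μ y' B →
        ∀ x : PBond (PV d ℓ m K hd hL) 0, blkV1 hN D x = y →
          |T μ x - T' μ x|
            ≤ CG * (Φ y * B)
              * Real.exp (-(δ * min ((geomT D).dist y ⟨y'.1, hy'D⟩) ((geomT D').dist ⟨y.1, hyD'⟩ y')))
              * Real.exp (-(δ * dOmega D D' y.1.2 y'.1.2)))
    (hsmall : ((ℓ : ℝ) + 1) ^ (d + 3) * Real.exp (-(δ / 2 * ((R : ℝ) * (((ℓ : ℝ) + 1) * Mh) - 1))) ≤ 1)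
    (h261 : Ineq261With Ks (geomT D) δ (1 / 4)) (h261' : Ineq261With Ks' (geomT D') δ (1 / 4))
    (c : BondIdx (domT hN D hk)) (hc : IsCT hN D D' hk c.1) (f : PBond (PV d ℓ m K hd hL) 0)
    (hfD : D.lev (toBox hN f.src).1 = k) (hfD' : D'.lev (toBox hN f.src).1 = k) (hΦf : Φ' (blkV1 hN D' f) = Φ (blkV1 hN D f)) :
    |(T ∘ₗ onFun (QsE (domT hN D hk) ∘ₗ EE (domT hN D hk) hcf hw)) (Pi.single c 1) f
      - (T' ∘ₗ onFun (QsE (domT hN D' hk) ∘ₗ EE (domT hN D' hk) hcf hw'))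
          (Pi.single (⟨c.1, hc.2.2⟩ : BondIdx (domT hN D' hk)) 1) f|
      ≤ ((2 * (((ℓ + 1 : ℕ) : ℝ)) ^ (d + 1) * Real.exp (δ * ((ℓ : ℝ) + 3))) * A * (CQ + S * ((ℓ : ℝ) + 1) ^ (d + 5))
            * (2 * ((d : ℝ) + 1) * Ks)
          + S * (2 * (((ℓ + 1 : ℕ) : ℝ)) ^ (d + 1) * CG
              + (2 * (((ℓ + 1 : ℕ) : ℝ)) ^ (d + 1) * Real.exp (δ * ((ℓ : ℝ) + 3))) * A * (2 + ((ℓ : ℝ) + 1) ^ (d + 5)))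
            * (2 * ((d : ℝ) + 1) * Ks'))
        * (Φ (blkV1 hN D f) / pref cf (blkV1 hN D f))
        * Real.exp (δ * ((ℓ : ℝ) + 7))
        * Real.exp (-(δ / 4 * dOmega D D' (blkV1 hN D f).1.2 (β hN D hk c).1.2)) := by
  set K₁ : ℝ := (2 * (((ℓ + 1 : ℕ) : ℝ)) ^ (d + 1) * Real.exp (δ * ((ℓ : ℝ) + 3))) * A * (CQ + S * ((ℓ : ℝ) + 1) ^ (d + 5))
    with hK₁
  set K₂ : ℝ := S * (2 * (((ℓ + 1 : ℕ) : ℝ)) ^ (d + 1) * CG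
      + (2 * (((ℓ + 1 : ℕ) : ℝ)) ^ (d + 1) * Real.exp (δ * ((ℓ : ℝ) + 3))) * A * (2 + ((ℓ : ℝ) + 1) ^ (d + 5))) with hK₂
  set r : ℝ := Φ (blkV1 hN D f) / pref cf (blkV1 hN D f) with hr
  set E7 : ℝ := Real.exp (δ * ((ℓ : ℝ) + 7)) with hE7
  set EΩ : ℝ := Real.exp (-(δ / 4 * dOmega D D' (blkV1 hN D f).1.2 (β hN D hk c).1.2)) with hEΩ
  have hL0 : (0 : ℝ) ≤ (ℓ : ℝ) + 1 := by positivity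
  have hK₁0 : 0 ≤ K₁ := by positivity
  have hK₂0 : 0 ≤ K₂ := by positivity
  have hr0 : 0 ≤ r := div_nonneg (hΦ _) (pref_nonneg cf _)
  have hE70 : 0 ≤ E7 := (Real.exp_pos _).le
  have hEΩ0 : 0 ≤ EΩ := (Real.exp_pos _).le
  have hS1 := sum_exp_dist_beta_le hN hk D hk1 h261 (blkV1 hN D f)
  have hS2 := sum_exp_rho_le' hN hk D' hk1 h261' (⟨c.1, hc.2.2⟩ : BondIdx (domT hN D' hk))
  have h1 : ∀ u : BondIdx (domT hN D hk), |kerE hN D D' hk hcf hw hw' c hc u * colT hN D hk T u f|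
      ≤ K₁ * r * E7 * EΩ * Real.exp (-(δ / 4 * (geomT D).dist (blkV1 hN D f) (β hN D hk u))) := fun u =>
    abs_kerE_mul_colT_le hN D D' hk hcf hw hw' hk1 hRM hMh hP hΦ hA hS hCQ hδ hT hE hEΔ hsmall c hc f hfD hfD' u
  have h2 : ∀ v : BondIdx (domT hN D' hk),
      |ent hN D' hk (EE (domT hN D' hk) hcf hw') v ⟨c.1, hc.2.2⟩ * kerT hN D D' hk T T' f v|
      ≤ K₂ * r * E7 * EΩ * Real.exp (-(δ / 4 * rho hN D' hk ⟨c.1, hc.2.2⟩ v)) := fun v =>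
    abs_ent_mul_kerT_le hN D D' hk hcf hw' hk1 hRM hMh hP hΦ hΦ' hA hS hCG hδ hT hT' hE' hTΔ hsmall c hc f hfD hfD' hΦf v
  rw [TH_sub_eq hN D D' hk hcf hw hw' T T' c hc f]
  calc |∑ u, kerE hN D D' hk hcf hw hw' c hc u * colT hN D hk T u f
          + ∑ v, ent hN D' hk (EE (domT hN D' hk) hcf hw') v ⟨c.1, hc.2.2⟩ * kerT hN D D' hk T T' f v|
      ≤ |∑ u, kerE hN D D' hk hcf hw hw' c hc u * colT hN D hk T u f|
          + |∑ v, ent hN D' hk (EE (domT hN D' hk) hcf hw') v ⟨c.1, hc.2.2⟩ * kerT hN D D' hk T T' f v| :=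
        abs_add_le _ _
    _ ≤ ∑ u, |kerE hN D D' hk hcf hw hw' c hc u * colT hN D hk T u f|
          + ∑ v, |ent hN D' hk (EE (domT hN D' hk) hcf hw') v ⟨c.1, hc.2.2⟩ * kerT hN D D' hk T T' f v| :=
        add_le_add (Finset.abs_sum_le_sum_abs _ _) (Finset.abs_sum_le_sum_abs _ _)
    _ ≤ ∑ u : BondIdx (domT hN D hk), K₁ * r * E7 * EΩ * Real.exp (-(δ / 4 * (geomT D).dist (blkV1 hN D f) (β hN D hk u)))
          + ∑ v : BondIdx (domT hN D' hk), K₂ * r * E7 * EΩ * Real.exp (-(δ / 4 * rho hN D' hk ⟨c.1, hc.2.2⟩ v)) :=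
        add_le_add (Finset.sum_le_sum fun u _ => h1 u) (Finset.sum_le_sum fun v _ => h2 v)
    _ = K₁ * r * E7 * EΩ * ∑ u : BondIdx (domT hN D hk), Real.exp (-(δ / 4 * (geomT D).dist (blkV1 hN D f) (β hN D hk u)))
          + K₂ * r * E7 * EΩ * ∑ v : BondIdx (domT hN D' hk), Real.exp (-(δ / 4 * rho hN D' hk ⟨c.1, hc.2.2⟩ v)) := by
        rw [← Finset.mul_sum, ← Finset.mul_sum]
    _ ≤ K₁ * r * E7 * EΩ * (2 * ((d : ℝ) + 1) * Ks) + K₂ * r * E7 * EΩ * (2 * ((d : ℝ) + 1) * Ks') :=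
        add_le_add (mul_le_mul_of_nonneg_left hS1 (mul_nonneg (mul_nonneg (mul_nonneg hK₁0 hr0) hE70) hEΩ0))
          (mul_le_mul_of_nonneg_left hS2 (mul_nonneg (mul_nonneg (mul_nonneg hK₂0 hr0) hE70) hEΩ0))
    _ = _ := by ring

end Sum

/-! ## §6  Theorem 3.14 for `TQ*(QGQ*)⁻¹` at `U = 1`, hypothesis level: the geometric mean with the one-family (2.151) decays -/

section Final

variable (hN : ∀ μ, N0 ℓ Mh k P' μ = (PV d ℓ m K hd hL).sitesPerDir 0) (D D' : TDomains d ℓ Mh k P' R) (hk : k ≤ m + K)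
variable {cf : ℝ} (hcf : cf ≠ 0) {w : BondIdx (domT hN D hk) → ℝ} (hw : ∀ i, 0 < w i)
  {w' : BondIdx (domT hN D' hk) → ℝ} (hw' : ∀ i, 0 < w' i)

omit hd hL in
/-- the two trivial one-family decays give the `min` form: `X ≤ C(e^{−δm} + e^{−δm′}) ≤ 2C·e^{−½δ·min(m, m′)}`.
[cite: Balaban1985BackgroundPropagators, (3.154) p.427, bookkeeping] -/
theorem two_decays_le_min {X C δ m m' : ℝ} (hC : 0 ≤ C) (hδ : 0 ≤ δ) (hm : 0 ≤ m) (hm' : 0 ≤ m')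
    (h : X ≤ C * Real.exp (-(δ * m)) + C * Real.exp (-(δ * m'))) :
    X ≤ 2 * C * 1 * Real.exp (-(δ / 2 * min m m')) := by
  have h1 : Real.exp (-(δ * m)) ≤ Real.exp (-(δ / 2 * min m m')) :=
    Real.exp_le_exp.2 (by nlinarith [min_le_left m m', le_min hm hm'])
  have h2 : Real.exp (-(δ * m')) ≤ Real.exp (-(δ / 2 * min m m')) :=
    Real.exp_le_exp.2 (by nlinarith [min_le_right m m', le_min hm hm'])
  nlinarith [mul_le_mul_of_nonneg_left h1 hC, mul_le_mul_of_nonneg_left h2 hC]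

/-- **THEOREM 3.14 FOR `TQ*(QGQ*)⁻¹` AT `U = 1` (hypothesis level; `T = G`: `H`, `T = ∇_νG`: `∇_νH`).**  Under the hypotheses of
`TH_sub_omega_le` and the one-family (2.151) decays of both families at the fine bond `f` (`|(TQ*Ee_a)(f)| ≤ C_H·e^{−δd_T(y(f), βa)}`,
r03's `cor28_kLevel_H_DH` shape, `C_H` may carry the output factor of `f`), for a common top index bond `c` (twin `c̃`) and a fine bond `f`
whose site lies in `Ω = Ω_k ∩ Ω′_k`:
`|(TQ*Ee_c)(f) − (T′Q′*E′e_c̃)(f)| ≤ √(2C_H)·√(K_Ω·Φ(y(f))/pref(y(f)))·e^{−¼δ·min(d_T(y(f), βc), d_T′(y′(f), β′c̃))}·e^{−⅛δ·d(y(f), βc, Ω)}` —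
«the cube Δ(y) and the point y′ in the case of H», the inequality (2.151) «with the additional factor exp(−δ₀d(y, y′, Ω))» (the geometric
mean of the `Ω`-bound `TH_sub_omega_le` with the trivial bound, `B9Thm314GpFlatMultiLevelTorus.combined_bound`).
[cite: Balaban1985BackgroundPropagators, Thm 3.14 (3.154) pp.426–427; Balaban1984PropagatorsII, Cor. 2.8 (2.150)–(2.151) p.249] -/
theorem thm314_TH_of_hyps (hk1 : 1 ≤ k) (hRM : 2 ≤ R * Mh) (hMh : 1 ≤ Mh) (hP : ∀ μ, 1 ≤ P' μ)
    {T T' : Module.End ℝ (PBond (PV d ℓ m K hd hL) 0 → ℝ)} {Φ : ↥(bset D.toDomains) → ℝ} {Φ' : ↥(bset D'.toDomains) → ℝ}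
    {A S CQ CG δ Ks Ks' CH : ℝ} (hΦ : ∀ y, 0 ≤ Φ y) (hΦ' : ∀ y, 0 ≤ Φ' y) (hA : 0 ≤ A) (hS : 0 ≤ S) (hCQ : 0 ≤ CQ)
    (hCG : 0 ≤ CG) (hδ : 0 ≤ δ) (hCH : 0 ≤ CH)
    (hT : HasMajorant (g := geomT D) (blkV1 hN D) T (fun y y' => A * Φ y * Real.exp (-(δ * (geomT D).dist y y'))))
    (hT' : HasMajorant (g := geomT D') (blkV1 hN D') T' (fun y y' => A * Φ' y * Real.exp (-(δ * (geomT D').dist y y'))))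
    (hE : ∀ a b : BondIdx (domT hN D hk),
      |⟪EuclideanSpace.single a (1 : ℝ), EE (domT hN D hk) hcf hw (EuclideanSpace.single b (1 : ℝ))⟫_ℝ| ≤
        (lam hN D hk cf a)⁻¹ * (lam hN D hk cf b)⁻¹ * (S * Real.exp (-(δ * rho hN D hk a b))))
    (hE' : ∀ a b : BondIdx (domT hN D' hk),
      |⟪EuclideanSpace.single a (1 : ℝ), EE (domT hN D' hk) hcf hw' (EuclideanSpace.single b (1 : ℝ))⟫_ℝ| ≤
        (lam hN D' hk cf a)⁻¹ * (lam hN D' hk cf b)⁻¹ * (S * Real.exp (-(δ * rho hN D' hk a b))))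
    (hEΔ : ∀ (i : BondIdx (domT hN D hk)) (hi : IsCT hN D D' hk i.1) (i' : BondIdx (domT hN D' hk))
        (hi' : IsCT hN D D' hk i'.1),
      |⟪EuclideanSpace.single i (1 : ℝ), EE (domT hN D hk) hcf hw
            (EuclideanSpace.single (⟨i'.1, hi'.2.1⟩ : BondIdx (domT hN D hk)) (1 : ℝ))⟫_ℝ
          - ⟪EuclideanSpace.single (⟨i.1, hi.2.2⟩ : BondIdx (domT hN D' hk)) (1 : ℝ), EE (domT hN D' hk) hcf hw'
            (EuclideanSpace.single i' (1 : ℝ))⟫_ℝ|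
        ≤ CQ * ((lam hN D hk cf i)⁻¹ * (lam hN D' hk cf i')⁻¹)
          * Real.exp (-(δ * dOmega D D' (β hN D hk i).1.2 (β hN D' hk i').1.2)))
    (hTΔ : ∀ (y : ↥(bset D.toDomains)) (hyD' : y.1 ∈ bset D'.toDomains) (y' : ↥(bset D'.toDomains))
        (hy'D : y'.1 ∈ bset D.toDomains), y.1.1 = k → y'.1.1 = k →
        ∀ (μ : PBond (PV d ℓ m K hd hL) 0 → ℝ) (B : ℝ), BlockSupp (g := geomT D') (blkV1 hN D') μ y' B →
        ∀ x : PBond (PV d ℓ m K hd hL) 0, blkV1 hN D x = y →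
          |T μ x - T' μ x|
            ≤ CG * (Φ y * B)
              * Real.exp (-(δ * min ((geomT D).dist y ⟨y'.1, hy'D⟩) ((geomT D').dist ⟨y.1, hyD'⟩ y')))
              * Real.exp (-(δ * dOmega D D' y.1.2 y'.1.2)))
    (hsmall : ((ℓ : ℝ) + 1) ^ (d + 3) * Real.exp (-(δ / 2 * ((R : ℝ) * (((ℓ : ℝ) + 1) * Mh) - 1))) ≤ 1)
    (h261 : Ineq261With Ks (geomT D) δ (1 / 4)) (h261' : Ineq261With Ks' (geomT D') δ (1 / 4))
    (c : BondIdx (domT hN D hk)) (hc : IsCT hN D D' hk c.1) (f : PBond (PV d ℓ m K hd hL) 0)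
    (hfD : D.lev (toBox hN f.src).1 = k) (hfD' : D'.lev (toBox hN f.src).1 = k) (hΦf : Φ' (blkV1 hN D' f) = Φ (blkV1 hN D f))
    (hH : ∀ a : BondIdx (domT hN D hk),
      |(T ∘ₗ onFun (QsE (domT hN D hk) ∘ₗ EE (domT hN D hk) hcf hw)) (Pi.single a 1) f|
        ≤ CH * Real.exp (-(δ * (geomT D).dist (blkV1 hN D f) (β hN D hk a))))
    (hH' : ∀ a' : BondIdx (domT hN D' hk),
      |(T' ∘ₗ onFun (QsE (domT hN D' hk) ∘ₗ EE (domT hN D' hk) hcf hw')) (Pi.single a' 1) f|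
        ≤ CH * Real.exp (-(δ * (geomT D').dist (blkV1 hN D' f) (β hN D' hk a')))) :
    |(T ∘ₗ onFun (QsE (domT hN D hk) ∘ₗ EE (domT hN D hk) hcf hw)) (Pi.single c 1) f
      - (T' ∘ₗ onFun (QsE (domT hN D' hk) ∘ₗ EE (domT hN D' hk) hcf hw'))
          (Pi.single (⟨c.1, hc.2.2⟩ : BondIdx (domT hN D' hk)) 1) f|
      ≤ Real.sqrt (2 * CH)
          * Real.sqrt (((2 * (((ℓ + 1 : ℕ) : ℝ)) ^ (d + 1) * Real.exp (δ * ((ℓ : ℝ) + 3))) * A * (CQ + S * ((ℓ : ℝ) + 1) ^ (d + 5))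
                * (2 * ((d : ℝ) + 1) * Ks)
              + S * (2 * (((ℓ + 1 : ℕ) : ℝ)) ^ (d + 1) * CG
                  + (2 * (((ℓ + 1 : ℕ) : ℝ)) ^ (d + 1) * Real.exp (δ * ((ℓ : ℝ) + 3))) * A * (2 + ((ℓ : ℝ) + 1) ^ (d + 5)))
                * (2 * ((d : ℝ) + 1) * Ks'))
              * (Φ (blkV1 hN D f) / pref cf (blkV1 hN D f)) * Real.exp (δ * ((ℓ : ℝ) + 7)))
          * Real.exp (-(δ / 4 * min ((geomT D).dist (blkV1 hN D f) (β hN D hk c))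
              ((geomT D').dist (blkV1 hN D' f) (β hN D' hk ⟨c.1, hc.2.2⟩))))
          * Real.exp (-(δ / 8 * dOmega D D' (blkV1 hN D f).1.2 (β hN D hk c).1.2)) := by
  set KΩ : ℝ := ((2 * (((ℓ + 1 : ℕ) : ℝ)) ^ (d + 1) * Real.exp (δ * ((ℓ : ℝ) + 3))) * A * (CQ + S * ((ℓ : ℝ) + 1) ^ (d + 5))
        * (2 * ((d : ℝ) + 1) * Ks)
      + S * (2 * (((ℓ + 1 : ℕ) : ℝ)) ^ (d + 1) * CG
          + (2 * (((ℓ + 1 : ℕ) : ℝ)) ^ (d + 1) * Real.exp (δ * ((ℓ : ℝ) + 3))) * A * (2 + ((ℓ : ℝ) + 1) ^ (d + 5)))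
        * (2 * ((d : ℝ) + 1) * Ks'))
      * (Φ (blkV1 hN D f) / pref cf (blkV1 hN D f)) * Real.exp (δ * ((ℓ : ℝ) + 7)) with hKΩ
  -- the (2.61) constants are non-negative (a sum of exponentials is below them); light arithmetic first
  have hKs : 0 ≤ Ks := le_trans (Finset.sum_nonneg fun _ _ => (Real.exp_pos _).le) (h261 (blkV1 hN D f))
  have hKs' : 0 ≤ Ks' := le_trans (Finset.sum_nonneg fun _ _ => (Real.exp_pos _).le) (h261' (blkV1 hN D' f))
  have hr0 : 0 ≤ Φ (blkV1 hN D f) / pref cf (blkV1 hN D f) := div_nonneg (hΦ _) (pref_nonneg cf _)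
  have hKΩ0 : 0 ≤ KΩ := by positivity
  set m := (geomT D).dist (blkV1 hN D f) (β hN D hk c) with hm
  set m' := (geomT D').dist (blkV1 hN D' f) (β hN D' hk ⟨c.1, hc.2.2⟩) with hm'
  set dΩ := dOmega D D' (blkV1 hN D f).1.2 (β hN D hk c).1.2 with hdΩ
  have hm0 : 0 ≤ m := distT_nonneg (D := D) _ _
  have hm'0 : 0 ≤ m' := distT_nonneg (D := D') _ _
  set X := |(T ∘ₗ onFun (QsE (domT hN D hk) ∘ₗ EE (domT hN D hk) hcf hw)) (Pi.single c 1) f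
      - (T' ∘ₗ onFun (QsE (domT hN D' hk) ∘ₗ EE (domT hN D' hk) hcf hw'))
          (Pi.single (⟨c.1, hc.2.2⟩ : BondIdx (domT hN D' hk)) 1) f| with hX
  -- the `Ω`-bound
  have hΩ := TH_sub_omega_le hN D D' hk hcf hw hw' hk1 hRM hMh hP hΦ hΦ' hA hS hCQ hCG hδ hT hT' hE hE' hEΔ hTΔ hsmall h261 h261'
    c hc f hfD hfD' hΦf
  have h2 : X ≤ KΩ * 1 * Real.exp (-(1 / 2 * (δ / 2) * dΩ)) := by
    rw [show (1 : ℝ) / 2 * (δ / 2) * dΩ = δ / 4 * dΩ by ring, mul_one]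
    exact hΩ
  -- the trivial bound
  have htriv : X ≤ CH * Real.exp (-(δ * m)) + CH * Real.exp (-(δ * m')) := by
    rw [hX]
    exact (abs_sub _ _).trans (add_le_add (hH c) (hH' ⟨c.1, hc.2.2⟩))
  have h1 := two_decays_le_min hCH hδ hm0 hm'0 htriv
  have hcomb := combined_bound (δ := δ / 2) (mul_nonneg zero_le_two hCH) hKΩ0 zero_le_one h1 h2
  rw [show (1 : ℝ) / 2 * (δ / 2) * min m m' = δ / 4 * min m m' by ring,
    show (1 : ℝ) / 4 * (δ / 2) * dΩ = δ / 8 * dΩ by ring, mul_one] at hcomb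
  exact hcomb

end Final

end Literature.MathematicalPhysics.QuantumFieldTheory.Balaban1983to89.B9Thm314HFlatV1Transfer

end
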